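/-
Copyright (c) 2026. All rights reserved.
Released under Apache 2.0 license as described in the file LICENSE.
-/
import Literature.MathematicalPhysics.QuantumFieldTheory.Balaban1983to89.B4Lemma22LpLqTransfer

/-!
# B4 Lemma 2.2 (2.17): THE INTERPOLATION STEP p. 583 — AN ELEMENTARY RIESZ–THORIN THEOREM FOR NONNEGATIVE
KERNELS ON FINITE SETS, AND (2.17) OFF THE DIAGONAL FOR `G_k(□,Ã)` FROM SCALAR ZERO-FIELD CORNER DATA

This file supplies the INTERPOLATION STEP of the proof of (2.17) of [B4, Lemma 2.2] for the propagators `G_k(□,Ã)` in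
the typing of this lineage (`B4Lemma22LpStair.lpS`, `lpM`: counting-measure `ℓ^p` norms on a finite box, mixed norm
through `siteNorm`), and closes the off-diagonal reduction of `B4Lemma22LpLqTransfer`:

* §1–§2 **AN ELEMENTARY RIESZ–THORIN THEOREM FOR NONNEGATIVE KERNELS ON FINITE SETS.**  The print obtains (2.17) off
  the diagonal by «The Riesz-Thorin Theorem gives us finally (2.17) for G_k(□) and for all p, q described in the
  figure» (p. 583; the figure is the parallelogram with vertices `(0,0)`, `(1/p₁,0)`, `(1,1)`, `(1,1/p₁')` of the
  `(1/p,1/q)`-plane, «1/p − 1/p₁ ≤ 1/q ≤ 1/p»).  Mathlib has no Riesz–Thorin theorem.  For operators dominated by a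
  NONNEGATIVE kernel — which is how every bound of this lineage is obtained
  (`B4Lemma22ReduceZero.siteNorm_kron_row_le`, `B4Lemma22LpLqTransfer.lpM_kron_le_pq`) — the Riesz convexity theorem
  is elementary: with `ψ = φ^{1−θ}χ^θ`, `φ = ψ^{p/p₀}`, `χ = ψ^{p/p₁}`, Hölder through the kernel gives `Kψ ≤
  (Kφ)^{1−θ}(Kχ)^θ` pointwise (`kernel_geom_le`), Hölder for the norms gives `‖A^{1−θ}B^θ‖_q ≤
  ‖A‖_{q₀}^{1−θ}‖B‖_{q₁}^θ` (`lpS_geom_le`, `lpS_geom_le_sup`), and `‖φ‖_{p₀} = ‖ψ‖_p^{p/p₀}` (`lpS_rpow_eq`).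
  Results: `riesz_thorin_pos` (two finite corners `(p₀→q₀, M₀)`, `(p₁→q₁, M₁)` ⇒ `(p→q, M₀^{1−θ}M₁^θ)` at `1/p =
  (1−θ)/p₀ + θ/p₁`, `1/q = (1−θ)/q₀ + θ/q₁`) and `riesz_thorin_pos_sup` (finite corner + sup-target corner `(p₁→∞)`,
  `1/q = (1−θ)/q₀`) — all exponents positive reals, functions `≥ 0`.
* §3–§5 **THE p. 583 INFERENCE, TYPED**: scalar corner data for the zero-field kernels `|G_k(□)(y,x)|`,
  `|(D^η_μG_k(□))(y,x)|` (a finite corner, e.g. the diagonal; and the corner «the operators G_k(□), ∂^η_μG_k(□),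
  G_k(□)∂^{η*}_μ are bounded operators from L^{p₁}(□) with p₁ > d to L^∞(□)», (2.40)–(2.41)) ⇒ the vector bounds
  (`lpM_kron_interp`, `lpM_kron_interp_sup`) ⇒ (2.17) for `G_k(□,Ã)` members `G`, `D^η_{A₀,μ}G`, `D^η_{Ã,μ}G` at the
  interpolated pair with constant `2·M₀^{1−t}M₁^t` (`lemma22_17_pq_box_interp_sup`, `lemma22_17_pq_box_interp`;
  staircase contours `lemma22_17_pq_stair_interp_sup`), through `B4Lemma22LpLqTransfer.lemma22_17_pq_box`.  The corner
  constants `M₀, M₁` are hypotheses: THIS is where the print's `η`-bookkeeping lives (below).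
* §6–§7 **THE COUNTING-MEASURE CLOSURE, NO ZERO-FIELD ANTECEDENT LEFT**: on a finite set an entry is at most its
  column sum, so the tree's zero-field ROW and COLUMN sums (`B4Thm110ZeroBox.lemma22_zero_box_rowSum/colSum`,
  `B4Thm110ZeroBoxDeriv.lemma22_zero_box_deriv_rowSum`, `B4Lemma22ZeroBoxDerivDual.lemma22_zero_box_deriv_colSum`)
  give BOTH the diagonal corners (Schur, `corner_diag`) AND the corners `ℓ¹ → ℓ^∞` (`corner_sup`), `ℓ^p → ℓ^∞`
  (`corner_sup_p`) with the same constant; interpolation then gives `‖|G_k(□)|ψ‖_q ≤ c‖ψ‖_p` for ALL `1 ≤ p ≤ q < ∞`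
  (`kernel_pq_of_rowcol`, `zero_box_pq`, `zero_box_psup`), hence (2.17) for `G_k(□,Ã)` on boxes / staircase contours
  at ALL pairs `1 ≤ p ≤ q < ∞` (members 1, 2: `lemma22_17_pq_box_all`, `lemma22_17_pq_stair_all`; target `‖·‖_∞`:
  `lemma22_17_psup_box_all`; member 3 for `1 < p ≤ q < ∞`: `lemma22_17_pq_box_dual_all`, «Again by the duality
  argument») with ONE constant, uniformly over the window `a ∈ [amin,aplus]`, `m² ∈ [0,m2plus]`, `k ≥ 1`, the box, the
  contour system and the background field under the printed smallness hypotheses.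

HONEST SCOPE.  (1) Positive-kernel interpolation only (the Riesz convexity theorem for positive operators), not the
complex-interpolation Riesz–Thorin theorem of the print's Ref. [6]; it suffices here because all operator bounds of
the lineage are bounds for the dominating nonnegative kernel.  (2) COUNTING MEASURE: the constants of §6–§7 are
lattice-unit constants, uniform in the size of the box but WITHOUT any decay in `η = L^{-k}`.  The print's (2.17) is
stated for the `η`-weighted norms, for which uniformity of `c₂` in `η` inside the parallelogram «1/p − 1/p₁ ≤ 1/q ≤
1/p» is a STRONGER assertion off the diagonal (an extra factor `η^{(dim)(1/p−1/q)}` on the counting-measure operator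
norm); that decay is NOT proved in this file — it is exactly what the corner constant `M₁` of the `(p₁→∞)` corner
carries in §4–§5 ((2.41): `c'₂` with its `η^{−d/p₁}`-normalisation), where it remains a hypothesis; on the diagonal `q
= p` the two readings agree. So §4–§5 type the print's inference "corners ⇒ parallelogram" faithfully with free corner
constants, and §6–§7 are the unconditional counting-measure statement.  (3) Exponents are real; the source exponent `p
= ∞` is not typed in `lpS` (the `(∞,∞)` corner is `B4Lemma22SupStair`); targets `q = ∞` appear through `supN`.  (4)
Nothing is cited as a fact: every hypothesis is either an explicit binder or a tree theorem; all declarations are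
kernel-checked, standard axioms.

References: [B4] T. Balaban, Regularity and decay of lattice Green's functions, Comm. Math. Phys. 89 (1983) 571–597,
Lemma 2.2 (2.17) p. 578, proof pp. 579–583 (bib key `Balaban1983RegularityDecay`).  Mathlib:
`Real.inner_le_Lp_mul_Lq_of_nonneg`, `Real.Lr_rpow_le_Lp_mul_Lq_of_nonneg`, `Real.inner_le_weight_mul_Lp_of_nonneg`.
-/

namespace Literature.MathematicalPhysics.QuantumFieldTheory.Balaban1983to89.B4Lemma22InterpBox

open Finset Matrix
open scoped Kronecker
open Literature.MathematicalPhysics.QuantumFieldTheory.Balaban1983to89.B4GaugeCovariance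
open Literature.MathematicalPhysics.QuantumFieldTheory.Balaban1983to89.B4Lower18Regular (e1 lsum baseEmb stairContour
  stairContour_end green_box_l2_bound)
open Literature.MathematicalPhysics.QuantumFieldTheory.Balaban1983to89.B4Lemma21Region (siteNorm covDeriv)
open Literature.MathematicalPhysics.QuantumFieldTheory.Balaban1983to89.B4Reflection242 (nbrs boxDom)
open Literature.MathematicalPhysics.QuantumFieldTheory.Balaban1983to89.B4Lemma22Reduce231
open Literature.MathematicalPhysics.QuantumFieldTheory.Balaban1983to89.B4Lemma22ReduceZero
open Literature.MathematicalPhysics.QuantumFieldTheory.Balaban1983to89.B4Lemma22SupStair (stair_lsum_le)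
open Literature.MathematicalPhysics.QuantumFieldTheory.Balaban1983to89.B4Lemma22LpStair
open Literature.MathematicalPhysics.QuantumFieldTheory.Balaban1983to89.B4Lemma22LpLqTransfer

noncomputable section

variable {ι : Type} [Fintype ι] [DecidableEq ι]

/-! ## §1 Finite Hölder tools for the mixed geometric mean `A^{1−θ}B^θ` -/

section Holder

variable {X : Type*} [Fintype X]

omit [Fintype ι] [DecidableEq ι] in
/-- `‖g‖_p = (Σ g^p)^{1/p}` for a nonnegative `g` (no absolute values). [folklore] -/
theorem lpS_eq_of_nonneg {p : ℝ} {g : X → ℝ} (hg : ∀ x, 0 ≤ g x) : lpS p g = (∑ x, g x ^ p) ^ p⁻¹ := by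
  unfold lpS
  congr 1
  exact sum_congr rfl fun x _ => by rw [abs_of_nonneg (hg x)]

omit [Fintype ι] [DecidableEq ι] in
/-- **HÖLDER THROUGH A NONNEGATIVE WEIGHT**: `Σ_x w F^{1−θ} G^θ ≤ (Σ_x w F)^{1−θ} (Σ_x w G)^θ` for `w, F, G ≥ 0`,
`0 < θ < 1` (Mathlib `Real.inner_le_Lp_mul_Lq_of_nonneg` with the conjugate exponents `1/(1−θ)`, `1/θ`). [folklore] -/
theorem sum_weight_geom_le {θ : ℝ} (hθ0 : 0 < θ) (hθ1 : θ < 1) {w F G : X → ℝ}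
    (hw : ∀ x, 0 ≤ w x) (hF : ∀ x, 0 ≤ F x) (hG : ∀ x, 0 ≤ G x) :
    ∑ x, w x * (F x ^ (1 - θ) * G x ^ θ) ≤ (∑ x, w x * F x) ^ (1 - θ) * (∑ x, w x * G x) ^ θ := by
  have hθ1' : 0 < 1 - θ := sub_pos.2 hθ1
  have hconj : (1 / (1 - θ)).HolderConjugate (1 / θ) :=
    ⟨by rw [one_div, one_div, inv_inv, inv_inv, inv_one]; ring, one_div_pos.2 hθ1', one_div_pos.2 hθ0⟩
  have h := Real.inner_le_Lp_mul_Lq_of_nonneg univ hconj (f := fun x => (w x * F x) ^ (1 - θ))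
    (g := fun x => (w x * G x) ^ θ) (fun x _ => Real.rpow_nonneg (mul_nonneg (hw x) (hF x)) _)
    (fun x _ => Real.rpow_nonneg (mul_nonneg (hw x) (hG x)) _)
  have h1 : ∀ x, ((w x * F x) ^ (1 - θ)) ^ (1 / (1 - θ)) = w x * F x := fun x => by
    rw [← Real.rpow_mul (mul_nonneg (hw x) (hF x)), mul_one_div_cancel hθ1'.ne', Real.rpow_one]
  have h2 : ∀ x, ((w x * G x) ^ θ) ^ (1 / θ) = w x * G x := fun x => by
    rw [← Real.rpow_mul (mul_nonneg (hw x) (hG x)), mul_one_div_cancel hθ0.ne', Real.rpow_one]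
  have h3 : ∀ x, (w x * F x) ^ (1 - θ) * (w x * G x) ^ θ = w x * (F x ^ (1 - θ) * G x ^ θ) := fun x => by
    have hw1 : w x ^ (1 - θ) * w x ^ θ = w x := by
      rw [← Real.rpow_add' (hw x) (by norm_num : (1 - θ) + θ ≠ 0), sub_add_cancel, Real.rpow_one]
    rw [Real.mul_rpow (hw x) (hF x), Real.mul_rpow (hw x) (hG x)]
    calc w x ^ (1 - θ) * F x ^ (1 - θ) * (w x ^ θ * G x ^ θ)
        = w x ^ (1 - θ) * w x ^ θ * (F x ^ (1 - θ) * G x ^ θ) := by ring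
      _ = w x * (F x ^ (1 - θ) * G x ^ θ) := by rw [hw1]
  simp only [h1, h2, h3, one_div_one_div] at h
  exact h

omit [Fintype ι] [DecidableEq ι] in
/-- **HÖLDER FOR THE GEOMETRIC MEAN, TWO FINITE EXPONENTS**: for `A, B ≥ 0`, `0 < θ < 1`, `q₀, q₁ > 0` and
`1/q = (1−θ)/q₀ + θ/q₁`: `‖A^{1−θ}B^θ‖_q ≤ ‖A‖_{q₀}^{1−θ}‖B‖_{q₁}^θ` (Mathlib `Real.Lr_rpow_le_Lp_mul_Lq_of_nonneg` with
the Hölder triple `(q₀/(1−θ), q₁/θ, q)`). [folklore] -/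
theorem lpS_geom_le {θ q q₀ q₁ : ℝ} (hθ0 : 0 < θ) (hθ1 : θ < 1) (hq₀ : 0 < q₀) (hq₁ : 0 < q₁)
    (hq : q⁻¹ = (1 - θ) * q₀⁻¹ + θ * q₁⁻¹) {A B : X → ℝ} (hA : ∀ y, 0 ≤ A y) (hB : ∀ y, 0 ≤ B y) :
    lpS q (fun y => A y ^ (1 - θ) * B y ^ θ) ≤ lpS q₀ A ^ (1 - θ) * lpS q₁ B ^ θ := by
  have hθ1' : 0 < 1 - θ := sub_pos.2 hθ1
  have hqi : 0 < q⁻¹ := by rw [hq]; positivity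
  have hqpos : 0 < q := inv_pos.1 hqi
  have hqne : q ≠ 0 := hqpos.ne'
  have hq₀ne : q₀ ≠ 0 := hq₀.ne'
  have hq₁ne : q₁ ≠ 0 := hq₁.ne'
  have hθne : 1 - θ ≠ 0 := hθ1'.ne'
  have hθne' : θ ≠ 0 := hθ0.ne'
  have htri : (q₀ / (1 - θ)).HolderTriple (q₁ / θ) q :=
    ⟨by rw [inv_div, inv_div, hq]; ring, div_pos hq₀ hθ1', div_pos hq₁ hθ0⟩
  have h := Real.Lr_rpow_le_Lp_mul_Lq_of_nonneg univ htri (f := fun y => A y ^ (1 - θ)) (g := fun y => B y ^ θ)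
    (fun y _ => Real.rpow_nonneg (hA y) _) (fun y _ => Real.rpow_nonneg (hB y) _)
  have h1 : ∀ y, (A y ^ (1 - θ)) ^ (q₀ / (1 - θ)) = A y ^ q₀ := fun y => by
    rw [← Real.rpow_mul (hA y)]
    congr 1
    field_simp
  have h2 : ∀ y, (B y ^ θ) ^ (q₁ / θ) = B y ^ q₁ := fun y => by
    rw [← Real.rpow_mul (hB y)]
    congr 1
    field_simp
  simp only [h1, h2] at h
  -- `h : Σ (A^{1−θ}B^θ)^q ≤ (Σ A^{q₀})^{q/(q₀/(1−θ))} (Σ B^{q₁})^{q/(q₁/θ)}`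
  have hS₀ : 0 ≤ ∑ y, A y ^ q₀ := sum_nonneg fun y _ => Real.rpow_nonneg (hA y) _
  have hS₁ : 0 ≤ ∑ y, B y ^ q₁ := sum_nonneg fun y _ => Real.rpow_nonneg (hB y) _
  have hAB : ∀ y, 0 ≤ A y ^ (1 - θ) * B y ^ θ := fun y =>
    mul_nonneg (Real.rpow_nonneg (hA y) _) (Real.rpow_nonneg (hB y) _)
  rw [lpS_eq_of_nonneg hAB, lpS_eq_of_nonneg hA, lpS_eq_of_nonneg hB]
  calc (∑ y, (A y ^ (1 - θ) * B y ^ θ) ^ q) ^ q⁻¹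
      ≤ ((∑ y, A y ^ q₀) ^ (q / (q₀ / (1 - θ))) * (∑ y, B y ^ q₁) ^ (q / (q₁ / θ))) ^ q⁻¹ :=
        Real.rpow_le_rpow (sum_nonneg fun y _ => Real.rpow_nonneg (hAB y) _) h hqi.le
    _ = ((∑ y, A y ^ q₀) ^ q₀⁻¹) ^ (1 - θ) * ((∑ y, B y ^ q₁) ^ q₁⁻¹) ^ θ := by
        rw [Real.mul_rpow (Real.rpow_nonneg hS₀ _) (Real.rpow_nonneg hS₁ _), ← Real.rpow_mul hS₀,
          ← Real.rpow_mul hS₁, ← Real.rpow_mul hS₀, ← Real.rpow_mul hS₁]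
        congr 2
        · field_simp
        · field_simp

omit [Fintype ι] [DecidableEq ι] in
/-- **HÖLDER FOR THE GEOMETRIC MEAN, SUP CORNER**: for `A, B ≥ 0`, `B ≤ b`, `0 < θ < 1`, `q₀ > 0` and
`1/q = (1−θ)/q₀`: `‖A^{1−θ}B^θ‖_q ≤ ‖A‖_{q₀}^{1−θ} b^θ`. [folklore] -/
theorem lpS_geom_le_sup {θ q q₀ : ℝ} (hθ0 : 0 < θ) (hθ1 : θ < 1) (hq₀ : 0 < q₀) (hq : q⁻¹ = (1 - θ) * q₀⁻¹)
    {A B : X → ℝ} (hA : ∀ y, 0 ≤ A y) (hB : ∀ y, 0 ≤ B y) {b : ℝ} (hBb : ∀ y, B y ≤ b) :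
    lpS q (fun y => A y ^ (1 - θ) * B y ^ θ) ≤ lpS q₀ A ^ (1 - θ) * b ^ θ := by
  have hθ1' : 0 < 1 - θ := sub_pos.2 hθ1
  have hqi : 0 < q⁻¹ := by rw [hq]; positivity
  have hqpos : 0 < q := inv_pos.1 hqi
  have hqne : q ≠ 0 := hqpos.ne'
  have hq₀ne : q₀ ≠ 0 := hq₀.ne'
  have hθne : 1 - θ ≠ 0 := hθ1'.ne'
  have hθne' : θ ≠ 0 := hθ0.ne'
  have hqq₀ : (1 - θ) * q = q₀ := by
    have : q = (q⁻¹)⁻¹ := (inv_inv q).symm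
    rw [this, hq, mul_inv, inv_inv]
    field_simp
  have hAB : ∀ y, 0 ≤ A y ^ (1 - θ) * B y ^ θ := fun y =>
    mul_nonneg (Real.rpow_nonneg (hA y) _) (Real.rpow_nonneg (hB y) _)
  have hS₀ : 0 ≤ ∑ y, A y ^ q₀ := sum_nonneg fun y _ => Real.rpow_nonneg (hA y) _
  have hb : ∀ y, 0 ≤ b := fun y => (hB y).trans (hBb y)
  rw [lpS_eq_of_nonneg hAB, lpS_eq_of_nonneg hA]
  -- pointwise: `(A^{1−θ}B^θ)^q = A^{q₀} B^{θq} ≤ A^{q₀} b^{θq}`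
  have hpt : ∀ y, (A y ^ (1 - θ) * B y ^ θ) ^ q ≤ b ^ (θ * q) * A y ^ q₀ := fun y => by
    rw [Real.mul_rpow (Real.rpow_nonneg (hA y) _) (Real.rpow_nonneg (hB y) _), ← Real.rpow_mul (hA y),
      ← Real.rpow_mul (hB y), hqq₀, mul_comm]
    exact mul_le_mul_of_nonneg_right (Real.rpow_le_rpow (hB y) (hBb y) (by positivity))
      (Real.rpow_nonneg (hA y) _)
  calc (∑ y, (A y ^ (1 - θ) * B y ^ θ) ^ q) ^ q⁻¹
      ≤ (∑ y, b ^ (θ * q) * A y ^ q₀) ^ q⁻¹ :=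
        Real.rpow_le_rpow (sum_nonneg fun y _ => Real.rpow_nonneg (hAB y) _) (sum_le_sum fun y _ => hpt y) hqi.le
    _ = ((∑ y, A y ^ q₀) ^ q₀⁻¹) ^ (1 - θ) * b ^ θ := by
        rcases isEmpty_or_nonempty X with hX | hX
        · simp only [univ_eq_empty, sum_empty]
          rw [Real.zero_rpow (inv_ne_zero hqpos.ne'), Real.zero_rpow (inv_ne_zero hq₀.ne'), Real.zero_rpow hθ1'.ne',
            zero_mul]
        · obtain ⟨y₀⟩ := hX
          have hb0 : 0 ≤ b := hb y₀
          rw [← mul_sum, Real.mul_rpow (Real.rpow_nonneg hb0 _) hS₀, ← Real.rpow_mul hb0, ← Real.rpow_mul hS₀,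
            mul_comm]
          congr 2
          · field_simp
            linarith [hqq₀]
          · field_simp

end Holder

/-! ## §2 The elementary Riesz–Thorin theorem for nonnegative kernels (two Hölder steps) -/

section Interp

variable {X : Type*} [Fintype X] {Y : Type*} [Fintype Y]

omit [Fintype ι] [DecidableEq ι] in
/-- `‖ψ^{p/p₀}‖_{p₀} = ‖ψ‖_p^{p/p₀}` for `ψ ≥ 0`, `p, p₀ > 0`. [folklore] -/
theorem lpS_rpow_eq {p p₀ : ℝ} (hp : 0 < p) (hp₀ : 0 < p₀) {ψ : X → ℝ} (hψ : ∀ x, 0 ≤ ψ x) :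
    lpS p₀ (fun x => ψ x ^ (p / p₀)) = lpS p ψ ^ (p / p₀) := by
  have h1 : ∀ x, (ψ x ^ (p / p₀)) ^ p₀ = ψ x ^ p := fun x => by
    rw [← Real.rpow_mul (hψ x), div_mul_cancel₀ _ hp₀.ne']
  have hS : 0 ≤ ∑ x, ψ x ^ p := sum_nonneg fun x _ => Real.rpow_nonneg (hψ x) _
  rw [lpS_eq_of_nonneg (fun x => Real.rpow_nonneg (hψ x) _), lpS_eq_of_nonneg hψ]
  simp only [h1]
  rw [← Real.rpow_mul hS]
  congr 1
  field_simp

omit [Fintype ι] [DecidableEq ι] [Fintype Y] in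
/-- **THE KERNEL HÖLDER STEP**: for a nonnegative kernel `K` and `φ, χ ≥ 0`,
`(K(φ^{1−θ}χ^θ))(y) ≤ (Kφ)(y)^{1−θ} (Kχ)(y)^θ`. [folklore] -/
theorem kernel_geom_le {K : Matrix Y X ℝ} (hK : ∀ y x, 0 ≤ K y x) {θ : ℝ} (hθ0 : 0 < θ) (hθ1 : θ < 1)
    {φ χ : X → ℝ} (hφ : ∀ x, 0 ≤ φ x) (hχ : ∀ x, 0 ≤ χ x) (y : Y) :
    ∑ x, K y x * (φ x ^ (1 - θ) * χ x ^ θ) ≤ (∑ x, K y x * φ x) ^ (1 - θ) * (∑ x, K y x * χ x) ^ θ :=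
  sum_weight_geom_le hθ0 hθ1 (hK y) hφ hχ

omit [Fintype ι] [DecidableEq ι] in
/-- the exponent bookkeeping of the interpolation: `1/p = (1−θ)/p₀ + θ/p₁` gives `(p/p₀)(1−θ) + (p/p₁)θ = 1`
and `0 < p`. [folklore] -/
theorem interp_exponent {p p₀ p₁ θ : ℝ} (hp₀ : 0 < p₀) (hp₁ : 0 < p₁) (hθ0 : 0 < θ) (hθ1 : θ < 1)
    (hp : p⁻¹ = (1 - θ) * p₀⁻¹ + θ * p₁⁻¹) : 0 < p ∧ p / p₀ * (1 - θ) + p / p₁ * θ = 1 := by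
  have hθ1' : 0 < 1 - θ := sub_pos.2 hθ1
  have hpi : 0 < p⁻¹ := by rw [hp]; positivity
  have hppos : 0 < p := inv_pos.1 hpi
  refine ⟨hppos, ?_⟩
  calc p / p₀ * (1 - θ) + p / p₁ * θ = p * ((1 - θ) * p₀⁻¹ + θ * p₁⁻¹) := by ring
    _ = p * p⁻¹ := by rw [hp]
    _ = 1 := mul_inv_cancel₀ hppos.ne'

omit [Fintype ι] [DecidableEq ι] in
/-- if moreover `p₀, p₁ ≥ 1` then `1 ≤ p`. [folklore] -/
theorem interp_exponent_one_le {p p₀ p₁ θ : ℝ} (hp₀ : 1 ≤ p₀) (hp₁ : 1 ≤ p₁) (hθ0 : 0 < θ) (hθ1 : θ < 1)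
    (hp : p⁻¹ = (1 - θ) * p₀⁻¹ + θ * p₁⁻¹) : 1 ≤ p := by
  have hθ1' : 0 < 1 - θ := sub_pos.2 hθ1
  have hppos := (interp_exponent (zero_lt_one.trans_le hp₀) (zero_lt_one.trans_le hp₁) hθ0 hθ1 hp).1
  have h1 : p⁻¹ ≤ 1 := by
    rw [hp]
    calc (1 - θ) * p₀⁻¹ + θ * p₁⁻¹ ≤ (1 - θ) * 1 + θ * 1 :=
          add_le_add (mul_le_mul_of_nonneg_left (inv_le_one_of_one_le₀ hp₀) hθ1'.le)
            (mul_le_mul_of_nonneg_left (inv_le_one_of_one_le₀ hp₁) hθ0.le)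
      _ = 1 := by ring
  exact (inv_le_one₀ hppos).1 h1

omit [Fintype ι] [DecidableEq ι] in
/-- **ELEMENTARY RIESZ–THORIN FOR A NONNEGATIVE KERNEL, TWO FINITE CORNERS**: if `K ≥ 0` entrywise maps
`ℓ^{p₀} → ℓ^{q₀}` with bound `M₀` and `ℓ^{p₁} → ℓ^{q₁}` with bound `M₁` (on nonnegative functions, all exponents
positive reals), then for `0 < θ < 1`, `1/p = (1−θ)/p₀ + θ/p₁`, `1/q = (1−θ)/q₀ + θ/q₁` it maps `ℓ^p → ℓ^q` with bound
`M₀^{1−θ}M₁^θ` (on nonnegative functions).  Proof: `ψ = φ^{1−θ}χ^θ` with `φ = ψ^{p/p₀}`, `χ = ψ^{p/p₁}`; the kernel Hölder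
step `kernel_geom_le`; the norm Hölder step `lpS_geom_le`; `‖φ‖_{p₀} = ‖ψ‖_p^{p/p₀}`, `‖χ‖_{p₁} = ‖ψ‖_p^{p/p₁}`.
This is the positive-operator case of the print's «The Riesz-Thorin Theorem gives us finally (2.17) for G_k(□) and for all
p, q described in the figure» (p. 583), for which no complex interpolation is needed. [folklore] -/
theorem riesz_thorin_pos {K : Matrix Y X ℝ} (hK : ∀ y x, 0 ≤ K y x) {p₀ q₀ p₁ q₁ M₀ M₁ θ p q : ℝ}
    (hp₀ : 0 < p₀) (hq₀ : 0 < q₀) (hp₁ : 0 < p₁) (hq₁ : 0 < q₁) (hM₀ : 0 ≤ M₀) (hM₁ : 0 ≤ M₁)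
    (hθ0 : 0 < θ) (hθ1 : θ < 1) (hp : p⁻¹ = (1 - θ) * p₀⁻¹ + θ * p₁⁻¹) (hq : q⁻¹ = (1 - θ) * q₀⁻¹ + θ * q₁⁻¹)
    (h₀ : ∀ ψ : X → ℝ, (∀ x, 0 ≤ ψ x) → lpS q₀ (fun y => ∑ x, K y x * ψ x) ≤ M₀ * lpS p₀ ψ)
    (h₁ : ∀ ψ : X → ℝ, (∀ x, 0 ≤ ψ x) → lpS q₁ (fun y => ∑ x, K y x * ψ x) ≤ M₁ * lpS p₁ ψ)
    (ψ : X → ℝ) (hψ : ∀ x, 0 ≤ ψ x) :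
    lpS q (fun y => ∑ x, K y x * ψ x) ≤ M₀ ^ (1 - θ) * M₁ ^ θ * lpS p ψ := by
  have hθ1' : 0 < 1 - θ := sub_pos.2 hθ1
  obtain ⟨hppos, hkey⟩ := interp_exponent hp₀ hp₁ hθ0 hθ1 hp
  have hqi : 0 < q⁻¹ := by rw [hq]; positivity
  have hqpos : 0 < q := inv_pos.1 hqi
  set φ : X → ℝ := fun x => ψ x ^ (p / p₀) with hφdef
  set χ : X → ℝ := fun x => ψ x ^ (p / p₁) with hχdef
  have hφ : ∀ x, 0 ≤ φ x := fun x => Real.rpow_nonneg (hψ x) _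
  have hχ : ∀ x, 0 ≤ χ x := fun x => Real.rpow_nonneg (hψ x) _
  have hsplit : ∀ x, ψ x = φ x ^ (1 - θ) * χ x ^ θ := fun x => by
    simp only [hφdef, hχdef]
    rw [← Real.rpow_mul (hψ x), ← Real.rpow_mul (hψ x), ← Real.rpow_add' (hψ x) (by rw [hkey]; norm_num), hkey,
      Real.rpow_one]
  have hKψ : ∀ y, 0 ≤ ∑ x, K y x * ψ x := fun y => sum_nonneg fun x _ => mul_nonneg (hK y x) (hψ x)
  have hKφ : ∀ y, 0 ≤ ∑ x, K y x * φ x := fun y => sum_nonneg fun x _ => mul_nonneg (hK y x) (hφ x)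
  have hKχ : ∀ y, 0 ≤ ∑ x, K y x * χ x := fun y => sum_nonneg fun x _ => mul_nonneg (hK y x) (hχ x)
  have hpt : ∀ y, ∑ x, K y x * ψ x ≤ (∑ x, K y x * φ x) ^ (1 - θ) * (∑ x, K y x * χ x) ^ θ := fun y =>
    calc ∑ x, K y x * ψ x = ∑ x, K y x * (φ x ^ (1 - θ) * χ x ^ θ) :=
          sum_congr rfl fun x _ => congrArg (K y x * ·) (hsplit x)
      _ ≤ _ := kernel_geom_le hK hθ0 hθ1 hφ hχ y
  have hφn : lpS p₀ φ = lpS p ψ ^ (p / p₀) := lpS_rpow_eq hppos hp₀ hψ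
  have hχn : lpS p₁ χ = lpS p ψ ^ (p / p₁) := lpS_rpow_eq hppos hp₁ hψ
  have hL : 0 ≤ lpS p ψ := lpS_nonneg _ _
  calc lpS q (fun y => ∑ x, K y x * ψ x)
      ≤ lpS q (fun y => (∑ x, K y x * φ x) ^ (1 - θ) * (∑ x, K y x * χ x) ^ θ) := lpS_mono' hqpos hKψ hpt
    _ ≤ lpS q₀ (fun y => ∑ x, K y x * φ x) ^ (1 - θ) * lpS q₁ (fun y => ∑ x, K y x * χ x) ^ θ :=
        lpS_geom_le hθ0 hθ1 hq₀ hq₁ hq hKφ hKχ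
    _ ≤ (M₀ * lpS p₀ φ) ^ (1 - θ) * (M₁ * lpS p₁ χ) ^ θ :=
        mul_le_mul (Real.rpow_le_rpow (lpS_nonneg _ _) (h₀ φ hφ) hθ1'.le)
          (Real.rpow_le_rpow (lpS_nonneg _ _) (h₁ χ hχ) hθ0.le) (Real.rpow_nonneg (lpS_nonneg _ _) _)
          (Real.rpow_nonneg (mul_nonneg hM₀ (lpS_nonneg _ _)) _)
    _ = M₀ ^ (1 - θ) * M₁ ^ θ * (lpS p ψ ^ (p / p₀ * (1 - θ)) * lpS p ψ ^ (p / p₁ * θ)) := by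
        rw [Real.mul_rpow hM₀ (lpS_nonneg _ _), Real.mul_rpow hM₁ (lpS_nonneg _ _), hφn, hχn, ← Real.rpow_mul hL,
          ← Real.rpow_mul hL]
        ring
    _ = M₀ ^ (1 - θ) * M₁ ^ θ * lpS p ψ := by
        rw [← Real.rpow_add' hL (by rw [hkey]; norm_num), hkey, Real.rpow_one]

omit [Fintype ι] [DecidableEq ι] in
/-- **ELEMENTARY RIESZ–THORIN FOR A NONNEGATIVE KERNEL, FINITE CORNER + SUP-TARGET CORNER**: if `K ≥ 0` maps
`ℓ^{p₀} → ℓ^{q₀}` with bound `M₀` and `ℓ^{p₁} → ℓ^∞` with bound `M₁` (sitewise: `(Kψ)(y) ≤ M₁‖ψ‖_{p₁}`), then for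
`0 < θ < 1`, `1/p = (1−θ)/p₀ + θ/p₁`, `1/q = (1−θ)/q₀` it maps `ℓ^p → ℓ^q` with bound `M₀^{1−θ}M₁^θ`.  This is the
corner configuration of p. 583: the diagonal / (2.16)-type corner and the corner «the operators G_k(□), ∂^η_μG_k(□),
G_k(□)∂^{η*}_μ are bounded operators from L^{p₁}(□) with p₁ > d to L^∞(□)» (2.40)–(2.41). [folklore] -/
theorem riesz_thorin_pos_sup {K : Matrix Y X ℝ} (hK : ∀ y x, 0 ≤ K y x) {p₀ q₀ p₁ M₀ M₁ θ p q : ℝ}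
    (hp₀ : 0 < p₀) (hq₀ : 0 < q₀) (hp₁ : 0 < p₁) (hM₀ : 0 ≤ M₀) (hM₁ : 0 ≤ M₁)
    (hθ0 : 0 < θ) (hθ1 : θ < 1) (hp : p⁻¹ = (1 - θ) * p₀⁻¹ + θ * p₁⁻¹) (hq : q⁻¹ = (1 - θ) * q₀⁻¹)
    (h₀ : ∀ ψ : X → ℝ, (∀ x, 0 ≤ ψ x) → lpS q₀ (fun y => ∑ x, K y x * ψ x) ≤ M₀ * lpS p₀ ψ)
    (h₁ : ∀ ψ : X → ℝ, (∀ x, 0 ≤ ψ x) → ∀ y, ∑ x, K y x * ψ x ≤ M₁ * lpS p₁ ψ)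
    (ψ : X → ℝ) (hψ : ∀ x, 0 ≤ ψ x) :
    lpS q (fun y => ∑ x, K y x * ψ x) ≤ M₀ ^ (1 - θ) * M₁ ^ θ * lpS p ψ := by
  have hθ1' : 0 < 1 - θ := sub_pos.2 hθ1
  obtain ⟨hppos, hkey⟩ := interp_exponent hp₀ hp₁ hθ0 hθ1 hp
  have hqi : 0 < q⁻¹ := by rw [hq]; positivity
  have hqpos : 0 < q := inv_pos.1 hqi
  set φ : X → ℝ := fun x => ψ x ^ (p / p₀) with hφdef
  set χ : X → ℝ := fun x => ψ x ^ (p / p₁) with hχdef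
  have hφ : ∀ x, 0 ≤ φ x := fun x => Real.rpow_nonneg (hψ x) _
  have hχ : ∀ x, 0 ≤ χ x := fun x => Real.rpow_nonneg (hψ x) _
  have hsplit : ∀ x, ψ x = φ x ^ (1 - θ) * χ x ^ θ := fun x => by
    simp only [hφdef, hχdef]
    rw [← Real.rpow_mul (hψ x), ← Real.rpow_mul (hψ x), ← Real.rpow_add' (hψ x) (by rw [hkey]; norm_num), hkey,
      Real.rpow_one]
  have hKψ : ∀ y, 0 ≤ ∑ x, K y x * ψ x := fun y => sum_nonneg fun x _ => mul_nonneg (hK y x) (hψ x)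
  have hKφ : ∀ y, 0 ≤ ∑ x, K y x * φ x := fun y => sum_nonneg fun x _ => mul_nonneg (hK y x) (hφ x)
  have hKχ : ∀ y, 0 ≤ ∑ x, K y x * χ x := fun y => sum_nonneg fun x _ => mul_nonneg (hK y x) (hχ x)
  have hpt : ∀ y, ∑ x, K y x * ψ x ≤ (∑ x, K y x * φ x) ^ (1 - θ) * (∑ x, K y x * χ x) ^ θ := fun y =>
    calc ∑ x, K y x * ψ x = ∑ x, K y x * (φ x ^ (1 - θ) * χ x ^ θ) :=
          sum_congr rfl fun x _ => congrArg (K y x * ·) (hsplit x)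
      _ ≤ _ := kernel_geom_le hK hθ0 hθ1 hφ hχ y
  have hφn : lpS p₀ φ = lpS p ψ ^ (p / p₀) := lpS_rpow_eq hppos hp₀ hψ
  have hχn : lpS p₁ χ = lpS p ψ ^ (p / p₁) := lpS_rpow_eq hppos hp₁ hψ
  have hL : 0 ≤ lpS p ψ := lpS_nonneg _ _
  calc lpS q (fun y => ∑ x, K y x * ψ x)
      ≤ lpS q (fun y => (∑ x, K y x * φ x) ^ (1 - θ) * (∑ x, K y x * χ x) ^ θ) := lpS_mono' hqpos hKψ hpt
    _ ≤ lpS q₀ (fun y => ∑ x, K y x * φ x) ^ (1 - θ) * (M₁ * lpS p₁ χ) ^ θ :=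
        lpS_geom_le_sup hθ0 hθ1 hq₀ hq hKφ hKχ (h₁ χ hχ)
    _ ≤ (M₀ * lpS p₀ φ) ^ (1 - θ) * (M₁ * lpS p₁ χ) ^ θ :=
        mul_le_mul_of_nonneg_right (Real.rpow_le_rpow (lpS_nonneg _ _) (h₀ φ hφ) hθ1'.le)
          (Real.rpow_nonneg (mul_nonneg hM₁ (lpS_nonneg _ _)) _)
    _ = M₀ ^ (1 - θ) * M₁ ^ θ * (lpS p ψ ^ (p / p₀ * (1 - θ)) * lpS p ψ ^ (p / p₁ * θ)) := by
        rw [Real.mul_rpow hM₀ (lpS_nonneg _ _), Real.mul_rpow hM₁ (lpS_nonneg _ _), hφn, hχn, ← Real.rpow_mul hL,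
          ← Real.rpow_mul hL]
        ring
    _ = M₀ ^ (1 - θ) * M₁ ^ θ * lpS p ψ := by
        rw [← Real.rpow_add' hL (by rw [hkey]; norm_num), hkey, Real.rpow_one]

end Interp

/-! ## §3 Vector lift: interpolated scalar-kernel bounds ⇒ bounds for `S ⊗ 1` in the mixed norms `lpM` -/

section Lift

variable {X : Type*} [Fintype X] {Y : Type*} [Fintype Y]

/-- **INTERPOLATED `ℓ^p → ℓ^q` BOUND FOR `S ⊗ 1`, TWO FINITE CORNERS**: scalar corner bounds for the kernel `|S(y,x)|`
at `(p₀→q₀, M₀)` and `(p₁→q₁, M₁)` give `‖(S⊗1)Φ‖_q ≤ M₀^{1−θ}M₁^θ‖Φ‖_p` at the interpolated pair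
(`riesz_thorin_pos` + `B4Lemma22LpLqTransfer.lpM_kron_le_pq`). [folklore] -/
theorem lpM_kron_interp {S : Matrix Y X ℝ} {p₀ q₀ p₁ q₁ M₀ M₁ θ p q : ℝ}
    (hp₀ : 0 < p₀) (hq₀ : 0 < q₀) (hp₁ : 0 < p₁) (hq₁ : 0 < q₁) (hM₀ : 0 ≤ M₀) (hM₁ : 0 ≤ M₁)
    (hθ0 : 0 < θ) (hθ1 : θ < 1) (hp : p⁻¹ = (1 - θ) * p₀⁻¹ + θ * p₁⁻¹) (hq : q⁻¹ = (1 - θ) * q₀⁻¹ + θ * q₁⁻¹)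
    (h₀ : ∀ ψ : X → ℝ, (∀ x, 0 ≤ ψ x) → lpS q₀ (fun y => ∑ x, |S y x| * ψ x) ≤ M₀ * lpS p₀ ψ)
    (h₁ : ∀ ψ : X → ℝ, (∀ x, 0 ≤ ψ x) → lpS q₁ (fun y => ∑ x, |S y x| * ψ x) ≤ M₁ * lpS p₁ ψ)
    (Φ : X × ι → ℝ) : lpM q ((S ⊗ₖ (1 : Matrix ι ι ℝ)) *ᵥ Φ) ≤ M₀ ^ (1 - θ) * M₁ ^ θ * lpM p Φ := by
  have hqi : 0 < q⁻¹ := by rw [hq]; have := sub_pos.2 hθ1; positivity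
  exact lpM_kron_le_pq (inv_pos.1 hqi)
    (riesz_thorin_pos (K := fun y x => |S y x|) (fun _ _ => abs_nonneg _) hp₀ hq₀ hp₁ hq₁ hM₀ hM₁ hθ0 hθ1 hp hq
      h₀ h₁) Φ

/-- **INTERPOLATED `ℓ^p → ℓ^q` BOUND FOR `S ⊗ 1`, FINITE CORNER + SUP CORNER**: scalar corner bounds for `|S(y,x)|`
at `(p₀→q₀, M₀)` and the sitewise `(p₁→∞, M₁)` give `‖(S⊗1)Φ‖_q ≤ M₀^{1−θ}M₁^θ‖Φ‖_p` for `1/q = (1−θ)/q₀`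
(`riesz_thorin_pos_sup` + `lpM_kron_le_pq`). [folklore] -/
theorem lpM_kron_interp_sup {S : Matrix Y X ℝ} {p₀ q₀ p₁ M₀ M₁ θ p q : ℝ}
    (hp₀ : 0 < p₀) (hq₀ : 0 < q₀) (hp₁ : 0 < p₁) (hM₀ : 0 ≤ M₀) (hM₁ : 0 ≤ M₁)
    (hθ0 : 0 < θ) (hθ1 : θ < 1) (hp : p⁻¹ = (1 - θ) * p₀⁻¹ + θ * p₁⁻¹) (hq : q⁻¹ = (1 - θ) * q₀⁻¹)
    (h₀ : ∀ ψ : X → ℝ, (∀ x, 0 ≤ ψ x) → lpS q₀ (fun y => ∑ x, |S y x| * ψ x) ≤ M₀ * lpS p₀ ψ)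
    (h₁ : ∀ ψ : X → ℝ, (∀ x, 0 ≤ ψ x) → ∀ y, ∑ x, |S y x| * ψ x ≤ M₁ * lpS p₁ ψ)
    (Φ : X × ι → ℝ) : lpM q ((S ⊗ₖ (1 : Matrix ι ι ℝ)) *ᵥ Φ) ≤ M₀ ^ (1 - θ) * M₁ ^ θ * lpM p Φ := by
  have hqi : 0 < q⁻¹ := by rw [hq]; have := sub_pos.2 hθ1; positivity
  exact lpM_kron_le_pq (inv_pos.1 hqi)
    (riesz_thorin_pos_sup (K := fun y x => |S y x|) (fun _ _ => abs_nonneg _) hp₀ hq₀ hp₁ hM₀ hM₁ hθ0 hθ1 hp hq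
      h₀ h₁) Φ

/-- composition of two `⊗1`-lifted kernels is the lift of the matrix product:
`(T⊗1)((S⊗1)Φ) = ((T·S)⊗1)Φ`. [folklore] -/
theorem kron_one_mulVec_kron_one {Z : Type*} [Fintype Z] (T : Matrix Z Y ℝ) (S : Matrix Y X ℝ) (Φ : X × ι → ℝ) :
    (T ⊗ₖ (1 : Matrix ι ι ℝ)) *ᵥ ((S ⊗ₖ (1 : Matrix ι ι ℝ)) *ᵥ Φ) = ((T * S) ⊗ₖ (1 : Matrix ι ι ℝ)) *ᵥ Φ := by
  rw [Matrix.mulVec_mulVec, ← Matrix.mul_kronecker_mul, Matrix.mul_one]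

end Lift

/-! ## §4 (2.17) off the diagonal for `G_k(□,Ã)` from SCALAR ZERO-FIELD CORNER DATA, by interpolation -/

section Box

variable {X : Type*} [Fintype X]

omit [Fintype ι] [DecidableEq ι] [Fintype X] in
/-- `1/q = (1−t)/q₀` with `q₀ ≥ 1`, `0 < t < 1` gives `1 ≤ q`. [folklore] -/
theorem interp_exponent_one_le_sup {q q₀ t : ℝ} (hq₀ : 1 ≤ q₀) (ht0 : 0 < t) (ht1 : t < 1)
    (hq : q⁻¹ = (1 - t) * q₀⁻¹) : 1 ≤ q := by
  have ht1' : 0 < 1 - t := sub_pos.2 ht1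
  have hq₀' : 0 < q₀ := zero_lt_one.trans_le hq₀
  have hqi : 0 < q⁻¹ := by rw [hq]; positivity
  have h1 : q⁻¹ ≤ 1 := by
    rw [hq]
    calc (1 - t) * q₀⁻¹ ≤ 1 * 1 :=
          mul_le_mul (by linarith) (inv_le_one_of_one_le₀ hq₀) (inv_nonneg.2 hq₀'.le) zero_le_one
      _ = 1 := one_mul _
  exact (inv_le_one₀ (inv_pos.1 hqi)).1 h1

/-- **(2.17) OFF THE DIAGONAL FOR `G_k(□,Ã)` ON A BOX, BY INTERPOLATION — THE p. 583 CONFIGURATION**: members `G`,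
`D^η_μG` (both conventions) at the pair `(p, q)` with `1/p = (1−t)/p₀ + t/p₁`, `1/q = (1−t)/q₀` (`0 < t < 1`), with the
constant `2·M₀^{1−t}M₁^t` (resp. `(1+ℓθ)·2·M₀^{1−t}M₁^t`), FROM the scalar zero-field corner data for the kernels
`|G_k(□)(y,x)|` and `|(D^η_μG_k(□))(y,x)|`: an `ℓ^{p₀} → ℓ^{q₀}` bound `M₀` (e.g. the diagonal `q₀ = p₀`, «The
Riesz-Thorin Theorem implies it for arbitrary q = p from [1,∞].») and a sitewise `ℓ^{p₁} → ℓ^∞` bound `M₁` («the operators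
G_k(□), ∂^η_μG_k(□), G_k(□)∂^{η*}_μ are bounded operators from L^{p₁}(□) with p₁ > d to L^∞(□)», (2.40)–(2.41)).  With
`q₀ = p₀ = s` ranging over `[1,∞)` this covers the triangle with vertices
`(0,0)`, `(1,1)`, `(1/p₁,0)` of the `(1/p,1/q)`-plane; the print's parallelogram «1/p − 1/p₁ ≤ 1/q ≤ 1/p» is the union of
this triangle and its dual image (third member / transposed kernels: `B4Lemma22LpLqTransfer.lemma22_17_pq_box_dual*`).
Engine: `riesz_thorin_pos_sup` → `lpM_kron_interp_sup` → `B4Lemma22LpLqTransfer.lemma22_17_pq_box`.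
[cite: Balaban1983RegularityDecay, Lemma 2.2 (2.17) p. 578; proof p. 581 (2.31)–(2.33), p. 583 (2.40)–(2.41)] -/
theorem lemma22_17_pq_box_interp_sup (F : OrthFlow ι) {ℓ₁ : ℝ} (hℓ₁ : 0 ≤ ℓ₁)
    (hLip : ∀ t (v : ι → ℝ), ((F.U t - 1) *ᵥ v) ⬝ᵥ ((F.U t - 1) *ᵥ v) ≤ (ℓ₁ * t) ^ 2 * (v ⬝ᵥ v))
    (κ : ℝ) (d ℓ : ℕ) (hℓ : 1 ≤ ℓ) (amin aplus m2plus : ℝ) (ha : 0 < amin) :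
    ∃ c : ℝ, 0 < c ∧ ∀ (k : ℕ), 1 ≤ k → ∀ (a m2 : ℝ), amin ≤ a → a ≤ aplus → 0 ≤ m2 → m2 ≤ m2plus →
      ∀ (M : Fin (d + 1) → ℕ), (∀ i, 1 ≤ M i) →
      ∀ (emb : ↥(boxDom M) → ↥(Box d ℓ k M)) (Γ : ↥(boxDom M) → ↥(Box d ℓ k M) → List ↥(Box d ℓ k M)),
        (∀ y x, blkWt ((ℓ + 1) ^ k) M (fun i => (ℓ + 1) ^ k * M i) y x ≠ 0 → pathEnd (emb y) (Γ y x) = x) →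
      ∀ (A₀ : Fin (d + 1) → ℝ) (A' : ↥(Box d ℓ k M) → ↥(Box d ℓ k M) → ℝ) (θ θ' τ : ℝ),
        IsUnit (opA d F κ ℓ k a m2 M emb Γ (constBond A₀ Subtype.val + A')).det →
        0 ≤ θ → (∀ x y : ↥(Box d ℓ k M), y.1 ∈ nbrs x.1 → |κ * A' x y| ≤ θ / ((ℓ + 1) ^ k : ℕ)) →
        0 ≤ θ' → (∀ (x z y : ↥(Box d ℓ k M)) (μ : Fin (d + 1)), z.1 = x.1 + e1 μ → y.1 = z.1 + e1 μ →
          |κ * (A' y z - A' z x)| ≤ θ' / (((ℓ + 1) ^ k : ℕ) : ℝ) ^ 2 ∧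
          |κ * (A' x z - A' z y)| ≤ θ' / (((ℓ + 1) ^ k : ℕ) : ℝ) ^ 2) →
        (∀ (x y : ↥(Box d ℓ k M)) (μ : Fin (d + 1)), y.1 = x.1 + e1 μ →
          (x.1 - e1 μ ∉ Box d ℓ k M ∨ y.1 + e1 μ ∉ Box d ℓ k M) → A' x y = 0 ∧ A' y x = 0) →
        0 ≤ τ → (∀ y x, blkWt ((ℓ + 1) ^ k) M (fun i => (ℓ + 1) ^ k * M i) y x ≠ 0 →
          |κ * lsum A' (emb y) (Γ y x)| ≤ τ) →
        ((d : ℝ) + 2) * c * (((d : ℝ) + 1) * ℓ₁ * (θ + θ') + ((d : ℝ) + 1) * ℓ₁ * θ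
          + ((d : ℝ) + 1) * ℓ₁ ^ 2 * θ ^ 2 + B1.aSeq a ((ℓ : ℝ) + 1) k * (ℓ₁ * τ * (2 + ℓ₁ * τ))) ≤ 1 / 2 →
        ∀ (p₀ q₀ p₁ M₀ M₁ t p q : ℝ), 1 ≤ p₀ → 1 ≤ q₀ → 1 ≤ p₁ → 0 ≤ M₀ → 0 ≤ M₁ → 0 < t → t < 1 →
          p⁻¹ = (1 - t) * p₀⁻¹ + t * p₁⁻¹ → q⁻¹ = (1 - t) * q₀⁻¹ →
          (∀ ψ : ↥(Box d ℓ k M) → ℝ, (∀ x, 0 ≤ ψ x) →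
            lpS q₀ (fun y => ∑ x, |gk d ℓ k a m2 M y x| * ψ x) ≤ M₀ * lpS p₀ ψ) →
          (∀ (μ : Fin (d + 1)) (ψ : ↥(Box d ℓ k M) → ℝ), (∀ x, 0 ≤ ψ x) →
            lpS q₀ (fun y => ∑ x, |(dk d ℓ k M μ * gk d ℓ k a m2 M) y x| * ψ x) ≤ M₀ * lpS p₀ ψ) →
          (∀ ψ : ↥(Box d ℓ k M) → ℝ, (∀ x, 0 ≤ ψ x) →
            ∀ y, ∑ x, |gk d ℓ k a m2 M y x| * ψ x ≤ M₁ * lpS p₁ ψ) →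
          (∀ (μ : Fin (d + 1)) (ψ : ↥(Box d ℓ k M) → ℝ), (∀ x, 0 ≤ ψ x) →
            ∀ y, ∑ x, |(dk d ℓ k M μ * gk d ℓ k a m2 M) y x| * ψ x ≤ M₁ * lpS p₁ ψ) →
        ∀ f : ↥(Box d ℓ k M) × ι → ℝ,
          lpM q (greenA d F κ ℓ k a m2 M emb Γ (constBond A₀ Subtype.val + A') *ᵥ f)
              ≤ 2 * (M₀ ^ (1 - t) * M₁ ^ t) * lpM p f ∧
          (∀ μ : Fin (d + 1),
            lpM q (derivA0 d F κ ℓ k M A₀ μ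
                *ᵥ (greenA d F κ ℓ k a m2 M emb Γ (constBond A₀ Subtype.val + A') *ᵥ f))
              ≤ 2 * (M₀ ^ (1 - t) * M₁ ^ t) * lpM p f) ∧
          ∀ μ : Fin (d + 1),
            lpM q (derivA d F κ ℓ k M (constBond A₀ Subtype.val + A') μ
                *ᵥ (greenA d F κ ℓ k a m2 M emb Γ (constBond A₀ Subtype.val + A') *ᵥ f))
              ≤ (1 + ℓ₁ * θ) * (2 * (M₀ ^ (1 - t) * M₁ ^ t)) * lpM p f := by
  obtain ⟨c, hc, h⟩ := lemma22_17_pq_box F hℓ₁ hLip κ d ℓ hℓ amin aplus m2plus ha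
  refine ⟨c, hc, ?_⟩
  intro k hk a m2 e1' e2 e3 e4 M hM emb Γ hend A₀ A' θ θ' τ hunit hθ hA' hθ' hder hbd hτ0 hτ hsm p₀ q₀ p₁ M₀ M₁ t
    p q hp₀ hq₀ hp₁ hM₀ hM₁ ht0 ht1 hp hq h₀ h₀' h₁ h₁' f
  have hp1 : 1 ≤ p := interp_exponent_one_le hp₀ hp₁ ht0 ht1 hp
  have hq1 : 1 ≤ q := interp_exponent_one_le_sup hq₀ ht0 ht1 hq
  have hC : 0 ≤ M₀ ^ (1 - t) * M₁ ^ t := mul_nonneg (Real.rpow_nonneg hM₀ _) (Real.rpow_nonneg hM₁ _)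
  have hp₀' : 0 < p₀ := zero_lt_one.trans_le hp₀
  have hq₀' : 0 < q₀ := zero_lt_one.trans_le hq₀
  have hp₁' : 0 < p₁ := zero_lt_one.trans_le hp₁
  exact h k hk a m2 e1' e2 e3 e4 M hM emb Γ hend A₀ A' θ θ' τ hunit hθ hA' hθ' hder hbd hτ0 hτ hsm p q hp1 hq1
    (M₀ ^ (1 - t) * M₁ ^ t) hC
    (fun Φ => lpM_kron_interp_sup hp₀' hq₀' hp₁' hM₀ hM₁ ht0 ht1 hp hq h₀ h₁ Φ)
    (fun μ Φ => by
      rw [kron_one_mulVec_kron_one]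
      exact lpM_kron_interp_sup hp₀' hq₀' hp₁' hM₀ hM₁ ht0 ht1 hp hq (h₀' μ) (h₁' μ) Φ) f

/-- **(2.17) OFF THE DIAGONAL FOR `G_k(□,Ã)` ON A BOX, BY INTERPOLATION BETWEEN TWO FINITE CORNERS**: the same
conclusion at `1/p = (1−t)/p₀ + t/p₁`, `1/q = (1−t)/q₀ + t/q₁` from scalar zero-field corner data `ℓ^{p₀}→ℓ^{q₀}` (`M₀`)
and `ℓ^{p₁}→ℓ^{q₁}` (`M₁`) for `|G_k(□)|`, `|D^η_μG_k(□)|` (e.g. the corners `(1,1)` and `(1, 1/p₁')` — the duals of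
the p. 583 corners).  Engine: `riesz_thorin_pos` → `lpM_kron_interp` → `lemma22_17_pq_box`.
[cite: Balaban1983RegularityDecay, Lemma 2.2 (2.17) p. 578; proof p. 581 (2.31)–(2.33), p. 583] -/
theorem lemma22_17_pq_box_interp (F : OrthFlow ι) {ℓ₁ : ℝ} (hℓ₁ : 0 ≤ ℓ₁)
    (hLip : ∀ t (v : ι → ℝ), ((F.U t - 1) *ᵥ v) ⬝ᵥ ((F.U t - 1) *ᵥ v) ≤ (ℓ₁ * t) ^ 2 * (v ⬝ᵥ v))
    (κ : ℝ) (d ℓ : ℕ) (hℓ : 1 ≤ ℓ) (amin aplus m2plus : ℝ) (ha : 0 < amin) :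
    ∃ c : ℝ, 0 < c ∧ ∀ (k : ℕ), 1 ≤ k → ∀ (a m2 : ℝ), amin ≤ a → a ≤ aplus → 0 ≤ m2 → m2 ≤ m2plus →
      ∀ (M : Fin (d + 1) → ℕ), (∀ i, 1 ≤ M i) →
      ∀ (emb : ↥(boxDom M) → ↥(Box d ℓ k M)) (Γ : ↥(boxDom M) → ↥(Box d ℓ k M) → List ↥(Box d ℓ k M)),
        (∀ y x, blkWt ((ℓ + 1) ^ k) M (fun i => (ℓ + 1) ^ k * M i) y x ≠ 0 → pathEnd (emb y) (Γ y x) = x) →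
      ∀ (A₀ : Fin (d + 1) → ℝ) (A' : ↥(Box d ℓ k M) → ↥(Box d ℓ k M) → ℝ) (θ θ' τ : ℝ),
        IsUnit (opA d F κ ℓ k a m2 M emb Γ (constBond A₀ Subtype.val + A')).det →
        0 ≤ θ → (∀ x y : ↥(Box d ℓ k M), y.1 ∈ nbrs x.1 → |κ * A' x y| ≤ θ / ((ℓ + 1) ^ k : ℕ)) →
        0 ≤ θ' → (∀ (x z y : ↥(Box d ℓ k M)) (μ : Fin (d + 1)), z.1 = x.1 + e1 μ → y.1 = z.1 + e1 μ →
          |κ * (A' y z - A' z x)| ≤ θ' / (((ℓ + 1) ^ k : ℕ) : ℝ) ^ 2 ∧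
          |κ * (A' x z - A' z y)| ≤ θ' / (((ℓ + 1) ^ k : ℕ) : ℝ) ^ 2) →
        (∀ (x y : ↥(Box d ℓ k M)) (μ : Fin (d + 1)), y.1 = x.1 + e1 μ →
          (x.1 - e1 μ ∉ Box d ℓ k M ∨ y.1 + e1 μ ∉ Box d ℓ k M) → A' x y = 0 ∧ A' y x = 0) →
        0 ≤ τ → (∀ y x, blkWt ((ℓ + 1) ^ k) M (fun i => (ℓ + 1) ^ k * M i) y x ≠ 0 →
          |κ * lsum A' (emb y) (Γ y x)| ≤ τ) →
        ((d : ℝ) + 2) * c * (((d : ℝ) + 1) * ℓ₁ * (θ + θ') + ((d : ℝ) + 1) * ℓ₁ * θ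
          + ((d : ℝ) + 1) * ℓ₁ ^ 2 * θ ^ 2 + B1.aSeq a ((ℓ : ℝ) + 1) k * (ℓ₁ * τ * (2 + ℓ₁ * τ))) ≤ 1 / 2 →
        ∀ (p₀ q₀ p₁ q₁ M₀ M₁ t p q : ℝ), 1 ≤ p₀ → 1 ≤ q₀ → 1 ≤ p₁ → 1 ≤ q₁ → 0 ≤ M₀ → 0 ≤ M₁ → 0 < t → t < 1 →
          p⁻¹ = (1 - t) * p₀⁻¹ + t * p₁⁻¹ → q⁻¹ = (1 - t) * q₀⁻¹ + t * q₁⁻¹ →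
          (∀ ψ : ↥(Box d ℓ k M) → ℝ, (∀ x, 0 ≤ ψ x) →
            lpS q₀ (fun y => ∑ x, |gk d ℓ k a m2 M y x| * ψ x) ≤ M₀ * lpS p₀ ψ) →
          (∀ (μ : Fin (d + 1)) (ψ : ↥(Box d ℓ k M) → ℝ), (∀ x, 0 ≤ ψ x) →
            lpS q₀ (fun y => ∑ x, |(dk d ℓ k M μ * gk d ℓ k a m2 M) y x| * ψ x) ≤ M₀ * lpS p₀ ψ) →
          (∀ ψ : ↥(Box d ℓ k M) → ℝ, (∀ x, 0 ≤ ψ x) →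
            lpS q₁ (fun y => ∑ x, |gk d ℓ k a m2 M y x| * ψ x) ≤ M₁ * lpS p₁ ψ) →
          (∀ (μ : Fin (d + 1)) (ψ : ↥(Box d ℓ k M) → ℝ), (∀ x, 0 ≤ ψ x) →
            lpS q₁ (fun y => ∑ x, |(dk d ℓ k M μ * gk d ℓ k a m2 M) y x| * ψ x) ≤ M₁ * lpS p₁ ψ) →
        ∀ f : ↥(Box d ℓ k M) × ι → ℝ,
          lpM q (greenA d F κ ℓ k a m2 M emb Γ (constBond A₀ Subtype.val + A') *ᵥ f)
              ≤ 2 * (M₀ ^ (1 - t) * M₁ ^ t) * lpM p f ∧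
          (∀ μ : Fin (d + 1),
            lpM q (derivA0 d F κ ℓ k M A₀ μ
                *ᵥ (greenA d F κ ℓ k a m2 M emb Γ (constBond A₀ Subtype.val + A') *ᵥ f))
              ≤ 2 * (M₀ ^ (1 - t) * M₁ ^ t) * lpM p f) ∧
          ∀ μ : Fin (d + 1),
            lpM q (derivA d F κ ℓ k M (constBond A₀ Subtype.val + A') μ
                *ᵥ (greenA d F κ ℓ k a m2 M emb Γ (constBond A₀ Subtype.val + A') *ᵥ f))
              ≤ (1 + ℓ₁ * θ) * (2 * (M₀ ^ (1 - t) * M₁ ^ t)) * lpM p f := by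
  obtain ⟨c, hc, h⟩ := lemma22_17_pq_box F hℓ₁ hLip κ d ℓ hℓ amin aplus m2plus ha
  refine ⟨c, hc, ?_⟩
  intro k hk a m2 e1' e2 e3 e4 M hM emb Γ hend A₀ A' θ θ' τ hunit hθ hA' hθ' hder hbd hτ0 hτ hsm p₀ q₀ p₁ q₁ M₀ M₁
    t p q hp₀ hq₀ hp₁ hq₁ hM₀ hM₁ ht0 ht1 hp hq h₀ h₀' h₁ h₁' f
  have hp1 : 1 ≤ p := interp_exponent_one_le hp₀ hp₁ ht0 ht1 hp
  have hq1 : 1 ≤ q := interp_exponent_one_le hq₀ hq₁ ht0 ht1 hq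
  have hC : 0 ≤ M₀ ^ (1 - t) * M₁ ^ t := mul_nonneg (Real.rpow_nonneg hM₀ _) (Real.rpow_nonneg hM₁ _)
  have hp₀' : 0 < p₀ := zero_lt_one.trans_le hp₀
  have hq₀' : 0 < q₀ := zero_lt_one.trans_le hq₀
  have hp₁' : 0 < p₁ := zero_lt_one.trans_le hp₁
  have hq₁' : 0 < q₁ := zero_lt_one.trans_le hq₁
  exact h k hk a m2 e1' e2 e3 e4 M hM emb Γ hend A₀ A' θ θ' τ hunit hθ hA' hθ' hder hbd hτ0 hτ hsm p q hp1 hq1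
    (M₀ ^ (1 - t) * M₁ ^ t) hC
    (fun Φ => lpM_kron_interp hp₀' hq₀' hp₁' hq₁' hM₀ hM₁ ht0 ht1 hp hq h₀ h₁ Φ)
    (fun μ Φ => by
      rw [kron_one_mulVec_kron_one]
      exact lpM_kron_interp hp₀' hq₀' hp₁' hq₁' hM₀ hM₁ ht0 ht1 hp hq (h₀' μ) (h₁' μ) Φ) f

end Box

/-! ## §5 The staircase-contour specialisation (operator-side hypotheses discharged) -/

section Stair

/-- **(2.17) OFF THE DIAGONAL FOR `G_k(□,Ã)` ON A FINE BOX WITH THE STAIRCASE CONTOURS, BY INTERPOLATION — THE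
p. 583 CONFIGURATION**, operator-side hypotheses discharged as in `B4Lemma22LpLqTransfer.lemma22_17_pq_stair`:
from the scalar zero-field corner data (`ℓ^{p₀}→ℓ^{q₀}` bound `M₀`, sitewise `ℓ^{p₁}→ℓ^∞` bound `M₁`, for `|G_k(□)|`
and `|D^η_μG_k(□)|`) the three conclusions at `1/p = (1−t)/p₀ + t/p₁`, `1/q = (1−t)/q₀` with constant
`2·M₀^{1−t}M₁^t`.  [cite: Balaban1983RegularityDecay, Lemma 2.2 (2.17) p. 578; proof pp. 579–583] -/
theorem lemma22_17_pq_stair_interp_sup (F : OrthFlow ι) {ℓ₁ : ℝ} (hℓ₁ : 0 ≤ ℓ₁)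
    (hLip : ∀ t (v : ι → ℝ), ((F.U t - 1) *ᵥ v) ⬝ᵥ ((F.U t - 1) *ᵥ v) ≤ (ℓ₁ * t) ^ 2 * (v ⬝ᵥ v))
    (κ : ℝ) (d ℓ : ℕ) (hℓ : 1 ≤ ℓ) (amin aplus m2plus : ℝ) (ha : 0 < amin) :
    ∃ c : ℝ, 0 < c ∧ ∀ (k : ℕ), 1 ≤ k → ∀ (hn : 1 ≤ (ℓ + 1) ^ k) (a m2 : ℝ),
      amin ≤ a → a ≤ aplus → 0 ≤ m2 → m2 ≤ m2plus →
      ∀ (M : Fin (d + 1) → ℕ), (∀ i, 1 ≤ M i) →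
      ∀ (A₀ : Fin (d + 1) → ℝ) (A' : ↥(Box d ℓ k M) → ↥(Box d ℓ k M) → ℝ) (θ θ' : ℝ),
        0 ≤ θ → (∀ x y : ↥(Box d ℓ k M), y.1 ∈ nbrs x.1 → |κ * A' x y| ≤ θ / ((ℓ + 1) ^ k : ℕ)) →
        0 ≤ θ' → (∀ (x z y : ↥(Box d ℓ k M)) (μ : Fin (d + 1)), z.1 = x.1 + e1 μ → y.1 = z.1 + e1 μ →
          |κ * (A' y z - A' z x)| ≤ θ' / (((ℓ + 1) ^ k : ℕ) : ℝ) ^ 2 ∧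
          |κ * (A' x z - A' z y)| ≤ θ' / (((ℓ + 1) ^ k : ℕ) : ℝ) ^ 2) →
        (∀ (x y : ↥(Box d ℓ k M)) (μ : Fin (d + 1)), y.1 = x.1 + e1 μ →
          (x.1 - e1 μ ∉ Box d ℓ k M ∨ y.1 + e1 μ ∉ Box d ℓ k M) → A' x y = 0 ∧ A' y x = 0) →
        ℓ₁ ^ 2 * θ ^ 2 * ((d : ℝ) + 1) * (1 + B1.aSeq a ((ℓ : ℝ) + 1) k * ((d : ℝ) + 1))
          ≤ min 2 (B1.aSeq a ((ℓ : ℝ) + 1) k) / 4 →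
        ((d : ℝ) + 2) * c * (((d : ℝ) + 1) * ℓ₁ * (θ + θ') + ((d : ℝ) + 1) * ℓ₁ * θ
          + ((d : ℝ) + 1) * ℓ₁ ^ 2 * θ ^ 2
          + B1.aSeq a ((ℓ : ℝ) + 1) k * (ℓ₁ * (((d : ℝ) + 1) * θ) * (2 + ℓ₁ * (((d : ℝ) + 1) * θ)))) ≤ 1 / 2 →
        ∀ (p₀ q₀ p₁ M₀ M₁ t p q : ℝ), 1 ≤ p₀ → 1 ≤ q₀ → 1 ≤ p₁ → 0 ≤ M₀ → 0 ≤ M₁ → 0 < t → t < 1 →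
          p⁻¹ = (1 - t) * p₀⁻¹ + t * p₁⁻¹ → q⁻¹ = (1 - t) * q₀⁻¹ →
          (∀ ψ : ↥(Box d ℓ k M) → ℝ, (∀ x, 0 ≤ ψ x) →
            lpS q₀ (fun y => ∑ x, |gk d ℓ k a m2 M y x| * ψ x) ≤ M₀ * lpS p₀ ψ) →
          (∀ (μ : Fin (d + 1)) (ψ : ↥(Box d ℓ k M) → ℝ), (∀ x, 0 ≤ ψ x) →
            lpS q₀ (fun y => ∑ x, |(dk d ℓ k M μ * gk d ℓ k a m2 M) y x| * ψ x) ≤ M₀ * lpS p₀ ψ) →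
          (∀ ψ : ↥(Box d ℓ k M) → ℝ, (∀ x, 0 ≤ ψ x) →
            ∀ y, ∑ x, |gk d ℓ k a m2 M y x| * ψ x ≤ M₁ * lpS p₁ ψ) →
          (∀ (μ : Fin (d + 1)) (ψ : ↥(Box d ℓ k M) → ℝ), (∀ x, 0 ≤ ψ x) →
            ∀ y, ∑ x, |(dk d ℓ k M μ * gk d ℓ k a m2 M) y x| * ψ x ≤ M₁ * lpS p₁ ψ) →
        ∀ f : ↥(Box d ℓ k M) × ι → ℝ,
          lpM q (greenA d F κ ℓ k a m2 M (baseEmb hn M) (stairContour hn M) (constBond A₀ Subtype.val + A') *ᵥ f)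
              ≤ 2 * (M₀ ^ (1 - t) * M₁ ^ t) * lpM p f ∧
          (∀ μ : Fin (d + 1),
            lpM q (derivA0 d F κ ℓ k M A₀ μ
                *ᵥ (greenA d F κ ℓ k a m2 M (baseEmb hn M) (stairContour hn M) (constBond A₀ Subtype.val + A')
                    *ᵥ f)) ≤ 2 * (M₀ ^ (1 - t) * M₁ ^ t) * lpM p f) ∧
          ∀ μ : Fin (d + 1),
            lpM q (derivA d F κ ℓ k M (constBond A₀ Subtype.val + A') μ
                *ᵥ (greenA d F κ ℓ k a m2 M (baseEmb hn M) (stairContour hn M) (constBond A₀ Subtype.val + A')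
                    *ᵥ f))
              ≤ (1 + ℓ₁ * θ) * (2 * (M₀ ^ (1 - t) * M₁ ^ t)) * lpM p f := by
  obtain ⟨c, hc, h⟩ := lemma22_17_pq_stair F hℓ₁ hLip κ d ℓ hℓ amin aplus m2plus ha
  refine ⟨c, hc, ?_⟩
  intro k hk hn a m2 e1' e2 e3 e4 M hM A₀ A' θ θ' hθ hA' hθ' hder hbd hsm2 hsm p₀ q₀ p₁ M₀ M₁ t p q hp₀ hq₀ hp₁ hM₀
    hM₁ ht0 ht1 hp hq h₀ h₀' h₁ h₁' f
  have hp1 : 1 ≤ p := interp_exponent_one_le hp₀ hp₁ ht0 ht1 hp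
  have hq1 : 1 ≤ q := interp_exponent_one_le_sup hq₀ ht0 ht1 hq
  have hC : 0 ≤ M₀ ^ (1 - t) * M₁ ^ t := mul_nonneg (Real.rpow_nonneg hM₀ _) (Real.rpow_nonneg hM₁ _)
  have hp₀' : 0 < p₀ := zero_lt_one.trans_le hp₀
  have hq₀' : 0 < q₀ := zero_lt_one.trans_le hq₀
  have hp₁' : 0 < p₁ := zero_lt_one.trans_le hp₁
  exact h k hk hn a m2 e1' e2 e3 e4 M hM A₀ A' θ θ' hθ hA' hθ' hder hbd hsm2 hsm p q hp1 hq1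
    (M₀ ^ (1 - t) * M₁ ^ t) hC
    (fun Φ => lpM_kron_interp_sup hp₀' hq₀' hp₁' hM₀ hM₁ ht0 ht1 hp hq h₀ h₁ Φ)
    (fun μ Φ => by
      rw [kron_one_mulVec_kron_one]
      exact lpM_kron_interp_sup hp₀' hq₀' hp₁' hM₀ hM₁ ht0 ht1 hp hq (h₀' μ) (h₁' μ) Φ) f

end Stair

/-! ## §6 THE ZERO-FIELD PAIR BOUNDS FOR ALL `1 ≤ p ≤ q < ∞` FROM THE TREE'S ROW AND COLUMN SUMS (counting measure) -/

section ZeroField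

variable {X : Type*} [Fintype X] {Y : Type*} [Fintype Y]

omit [Fintype ι] [DecidableEq ι] in
/-- `‖ψ‖₁ = Σψ` for `ψ ≥ 0`. [folklore] -/
theorem lpS_one_eq {ψ : X → ℝ} (hψ : ∀ x, 0 ≤ ψ x) : lpS 1 ψ = ∑ x, ψ x := by
  rw [lpS_eq_of_nonneg hψ, inv_one, Real.rpow_one]
  exact sum_congr rfl fun x _ => Real.rpow_one _

omit [Fintype ι] [DecidableEq ι] in
/-- **THE DIAGONAL CORNER FROM ROW AND COLUMN SUMS** (the scalar Schur test `B4Lemma22LpStair.lpS_schur`):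
`Σ_x|S(y,x)| ≤ B`, `Σ_y|S(y,x)| ≤ B` ⇒ `‖|S|ψ‖_s ≤ B‖ψ‖_s` for every `s ≥ 1`. [folklore] -/
theorem corner_diag {S : Matrix Y X ℝ} {B : ℝ} (hB : 0 ≤ B) (hR : ∀ y, ∑ x, |S y x| ≤ B)
    (hC : ∀ x, ∑ y, |S y x| ≤ B) {s : ℝ} (hs : 1 ≤ s) (ψ : X → ℝ) (hψ : ∀ x, 0 ≤ ψ x) :
    lpS s (fun y => ∑ x, |S y x| * ψ x) ≤ B * lpS s ψ :=
  lpS_schur hs (fun _ => sum_nonneg fun x _ => mul_nonneg (abs_nonneg _) (hψ x)) hψ (fun _ _ => abs_nonneg _)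
    (fun _ => le_rfl) hB hR hC

omit [Fintype ι] [DecidableEq ι] in
/-- **THE `ℓ¹ → ℓ^∞` CORNER FROM COLUMN SUMS**: an entry is at most its column sum, so `(|S|ψ)(y) ≤ B‖ψ‖₁`.
[folklore] -/
theorem corner_sup {S : Matrix Y X ℝ} {B : ℝ} (hC : ∀ x, ∑ y, |S y x| ≤ B) (ψ : X → ℝ) (hψ : ∀ x, 0 ≤ ψ x)
    (y : Y) : ∑ x, |S y x| * ψ x ≤ B * lpS 1 ψ := by
  rw [lpS_one_eq hψ, mul_sum]
  exact sum_le_sum fun x _ => mul_le_mul_of_nonneg_right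
    ((single_le_sum (s := univ) (f := fun y' => |S y' x|) (fun _ _ => abs_nonneg _) (mem_univ y)).trans (hC x))
    (hψ x)

omit [Fintype ι] [DecidableEq ι] in
/-- **THE `ℓ^p → ℓ^∞` CORNER FOR EVERY `p ≥ 1` FROM ROW AND COLUMN SUMS**: `(|S|ψ)(y) ≤ (Σ_x|S(y,x)|)^{1−1/p}
(Σ_x|S(y,x)|ψ(x)^p)^{1/p} ≤ B^{1−1/p}(B‖ψ‖_p^p)^{1/p} = B‖ψ‖_p` (weighted power mean, Mathlib
`Real.inner_le_weight_mul_Lp_of_nonneg`; entries ≤ column sums). [folklore] -/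
theorem corner_sup_p {S : Matrix Y X ℝ} {B : ℝ} (hB : 0 ≤ B) (hR : ∀ y, ∑ x, |S y x| ≤ B)
    (hC : ∀ x, ∑ y, |S y x| ≤ B) {p : ℝ} (hp : 1 ≤ p) (ψ : X → ℝ) (hψ : ∀ x, 0 ≤ ψ x) (y : Y) :
    ∑ x, |S y x| * ψ x ≤ B * lpS p ψ := by
  have hp0 : 0 < p := by linarith
  have hE : ∀ x, |S y x| ≤ B := fun x =>
    (single_le_sum (s := univ) (f := fun y' => |S y' x|) (fun _ _ => abs_nonneg _) (mem_univ y)).trans (hC x)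
  have hw := Real.inner_le_weight_mul_Lp_of_nonneg (univ : Finset X) hp (fun x => |S y x|) ψ
    (fun _ => abs_nonneg _) hψ
  have hS0 : 0 ≤ ∑ x, |S y x| := sum_nonneg fun _ _ => abs_nonneg _
  have hT0 : 0 ≤ ∑ x, |S y x| * ψ x ^ p := sum_nonneg fun x _ => mul_nonneg (abs_nonneg _) (Real.rpow_nonneg (hψ x) _)
  have hP0 : 0 ≤ ∑ x, ψ x ^ p := sum_nonneg fun x _ => Real.rpow_nonneg (hψ x) _
  have h1 : (∑ x, |S y x|) ^ (1 - p⁻¹) ≤ B ^ (1 - p⁻¹) :=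
    Real.rpow_le_rpow hS0 (hR y) (sub_nonneg.2 (inv_le_one_of_one_le₀ hp))
  have h2 : (∑ x, |S y x| * ψ x ^ p) ^ p⁻¹ ≤ (B * ∑ x, ψ x ^ p) ^ p⁻¹ :=
    Real.rpow_le_rpow hT0 (by
      rw [mul_sum]
      exact sum_le_sum fun x _ => mul_le_mul_of_nonneg_right (hE x) (Real.rpow_nonneg (hψ x) _))
      (inv_nonneg.2 hp0.le)
  calc ∑ x, |S y x| * ψ x ≤ (∑ x, |S y x|) ^ (1 - p⁻¹) * (∑ x, |S y x| * ψ x ^ p) ^ p⁻¹ := hw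
    _ ≤ B ^ (1 - p⁻¹) * (B * ∑ x, ψ x ^ p) ^ p⁻¹ :=
        mul_le_mul h1 h2 (Real.rpow_nonneg hT0 _) (Real.rpow_nonneg hB _)
    _ = B * lpS p ψ := by
        rw [Real.mul_rpow hB hP0, ← mul_assoc, ← Real.rpow_add' hB (by norm_num), sub_add_cancel, Real.rpow_one,
          lpS_eq_of_nonneg hψ]

omit [Fintype ι] [DecidableEq ι] in
/-- **ALL PAIRS `1 ≤ p ≤ q < ∞` FROM ROW AND COLUMN SUMS, SAME CONSTANT**: `Σ_x|S(y,x)| ≤ B`, `Σ_y|S(y,x)| ≤ B` ⇒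
`‖|S|ψ‖_q ≤ B‖ψ‖_p` — the diagonal corner `(s,s)` with `s = (1 − 1/p + 1/q)·q ≥ 1` and the corner `ℓ¹ → ℓ^∞` interpolated
by `riesz_thorin_pos_sup` with `t = 1/p − 1/q` (`B^{1−t}B^t = B`).  In counting measure on a finite set this is the
whole range `q ≥ p`; the print's restriction «1/p − 1/p₁ ≤ 1/q ≤ 1/p» concerns the `η`-weighted norms, i.e. the SIZE of the
constant in powers of `η` (see the module docstring). [folklore] -/
theorem kernel_pq_of_rowcol {S : Matrix Y X ℝ} {B : ℝ} (hB : 0 ≤ B) (hR : ∀ y, ∑ x, |S y x| ≤ B)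
    (hC : ∀ x, ∑ y, |S y x| ≤ B) {p q : ℝ} (hp : 1 ≤ p) (hpq : p ≤ q) (ψ : X → ℝ) (hψ : ∀ x, 0 ≤ ψ x) :
    lpS q (fun y => ∑ x, |S y x| * ψ x) ≤ B * lpS p ψ := by
  rcases eq_or_lt_of_le hpq with rfl | hlt
  · exact corner_diag hB hR hC hp ψ hψ
  · have hp0 : 0 < p := by linarith
    have hq0 : 0 < q := by linarith
    have hpi1 : p⁻¹ ≤ 1 := inv_le_one_of_one_le₀ hp
    have hqi0 : 0 < q⁻¹ := inv_pos.2 hq0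
    set t : ℝ := p⁻¹ - q⁻¹ with ht
    have ht0 : 0 < t := sub_pos.2 ((inv_lt_inv₀ hq0 hp0).2 hlt)
    have ht1 : t < 1 := by linarith
    have h1t : 0 < 1 - t := sub_pos.2 ht1
    set s : ℝ := (1 - t) * q with hs
    have hs1 : 1 ≤ s := by
      have h1 : s = q * (1 - p⁻¹) + q * q⁻¹ := by rw [hs, ht]; ring
      rw [h1, mul_inv_cancel₀ hq0.ne']
      nlinarith
    have hs0 : 0 < s := by linarith
    have hrel_q : q⁻¹ = (1 - t) * s⁻¹ := by
      rw [hs, mul_inv, ← mul_assoc, mul_inv_cancel₀ h1t.ne', one_mul]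
    have hrel_p : p⁻¹ = (1 - t) * s⁻¹ + t * (1 : ℝ)⁻¹ := by
      rw [← hrel_q, inv_one, mul_one, ht]
      ring
    have key := riesz_thorin_pos_sup (K := fun y x => |S y x|) (fun _ _ => abs_nonneg _) hs0 hs0 one_pos hB hB
      ht0 ht1 hrel_p hrel_q (fun φ hφ => corner_diag hB hR hC hs1 φ hφ) (fun φ hφ => corner_sup hC φ hφ) ψ hψ
    have hBB : B ^ (1 - t) * B ^ t = B := by
      rw [← Real.rpow_add' hB (by norm_num), sub_add_cancel, Real.rpow_one]
    rw [hBB] at key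
    exact key

open Literature.MathematicalPhysics.QuantumFieldTheory.Balaban1983to89.B4Thm110ZeroBox (lemma22_zero_box_rowSum
  lemma22_zero_box_colSum)
open Literature.MathematicalPhysics.QuantumFieldTheory.Balaban1983to89.B4Thm110ZeroBoxDeriv
  (lemma22_zero_box_deriv_rowSum)
open Literature.MathematicalPhysics.QuantumFieldTheory.Balaban1983to89.B4Lemma22ZeroBoxDerivDual
  (fwd lemma22_zero_box_deriv_colSum)

/-- **(2.17) AT `A = 0`, MEMBERS `n = 0, 1`, ALL PAIRS `1 ≤ p ≤ q < ∞`, ONE CONSTANT (counting measure)**: uniformly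
over the window and the box, `‖(G_k(□)⊗1)Φ‖_q ≤ c‖Φ‖_p` and `‖(D^η_μ⊗1)(G_k(□)⊗1)Φ‖_q ≤ c‖Φ‖_p`, from the tree's
zero-field ROW sums (`B4Thm110ZeroBox.lemma22_zero_box_rowSum`, `B4Thm110ZeroBoxDeriv.lemma22_zero_box_deriv_rowSum`)
and COLUMN sums (`lemma22_zero_box_colSum`, `B4Lemma22ZeroBoxDerivDual.lemma22_zero_box_deriv_colSum`) by
`kernel_pq_of_rowcol` and the vector lift `B4Lemma22LpLqTransfer.lpM_kron_le_pq`.  This extends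
`B4Lemma22LpStair.zero_box_lp` (`q = p`) off the diagonal.
[cite: Balaban1983RegularityDecay, Lemma 2.2 (2.17) p. 578; p. 583] -/
theorem zero_box_pq (ι : Type) [Fintype ι] [DecidableEq ι] (d ℓ : ℕ) (hℓ : 1 ≤ ℓ)
    (amin aplus m2plus : ℝ) (ha : 0 < amin) :
    ∃ c : ℝ, 0 < c ∧ ∀ (k : ℕ), 1 ≤ k → ∀ (a m2 : ℝ), amin ≤ a → a ≤ aplus → 0 ≤ m2 → m2 ≤ m2plus →
      ∀ (M : Fin (d + 1) → ℕ), (∀ i, 1 ≤ M i) → ∀ (p q : ℝ), 1 ≤ p → p ≤ q →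
        (∀ Φ : ↥(Box d ℓ k M) × ι → ℝ,
            lpM q ((gk d ℓ k a m2 M ⊗ₖ (1 : Matrix ι ι ℝ)) *ᵥ Φ) ≤ c * lpM p Φ) ∧
        (∀ (μ : Fin (d + 1)) (Φ : ↥(Box d ℓ k M) × ι → ℝ),
            lpM q ((dk d ℓ k M μ ⊗ₖ (1 : Matrix ι ι ℝ)) *ᵥ ((gk d ℓ k a m2 M ⊗ₖ (1 : Matrix ι ι ℝ)) *ᵥ Φ))
              ≤ c * lpM p Φ) := by
  obtain ⟨c₁, hc₁, h₁⟩ := lemma22_zero_box_rowSum d ℓ hℓ amin aplus m2plus ha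
  obtain ⟨c₁', hc₁', h₁'⟩ := lemma22_zero_box_colSum d ℓ hℓ amin aplus m2plus ha
  obtain ⟨c₂, hc₂, h₂⟩ := lemma22_zero_box_deriv_rowSum d ℓ hℓ amin aplus m2plus ha
  obtain ⟨c₂', hc₂', h₂'⟩ := lemma22_zero_box_deriv_colSum d ℓ hℓ amin aplus m2plus ha
  refine ⟨max (max c₁ c₁') (max c₂ c₂'), lt_max_of_lt_left (lt_max_of_lt_left hc₁), ?_⟩
  intro k hk a m2 e1 e2 e3 e4 M hM p q hp hpq
  have hc0 : 0 ≤ max (max c₁ c₁') (max c₂ c₂') := le_max_of_le_left (le_max_of_le_left hc₁.le)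
  have hq0 : 0 < q := by linarith
  refine ⟨fun Φ => ?_, fun μ Φ => ?_⟩
  · exact lpM_kron_le_pq hq0 (kernel_pq_of_rowcol hc0
      (fun y => (h₁ k hk a m2 e1 e2 e3 e4 M hM y).trans ((le_max_left _ _).trans (le_max_left _ _)))
      (fun x' => (h₁' k hk a m2 e1 e2 e3 e4 M hM x').trans ((le_max_right _ _).trans (le_max_left _ _)))
      hp hpq) Φ
  · rw [kron_one_mulVec_kron_one]
    refine lpM_kron_le_pq hq0 (kernel_pq_of_rowcol hc0 (fun y => ?_) (fun x' => ?_) hp hpq) Φ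
    · exact (rowSum_fdiffM_mul_le _ hc₂.le (fun x xe hxe => h₂ k hk a m2 e1 e2 e3 e4 M hM μ x xe hxe) y).trans
        ((le_max_left _ _).trans (le_max_right _ _))
    · calc ∑ x, |(dk d ℓ k M μ * gk d ℓ k a m2 M) x x'|
            = ∑ x, |((((ℓ + 1) ^ k : ℕ) : ℝ)) * (gk d ℓ k a m2 M (fwd _ μ x) x' - gk d ℓ k a m2 M x x')| :=
              sum_congr rfl fun x _ => by rw [fdiffM_mul_apply_fwd]
        _ ≤ c₂' := h₂' k hk a m2 e1 e2 e3 e4 M hM μ x'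
        _ ≤ max (max c₁ c₁') (max c₂ c₂') := (le_max_right _ _).trans (le_max_right _ _)

/-- **(2.17) AT `A = 0`, MEMBERS `n = 0, 1`, TARGET `‖·‖_∞`, EVERY `p ≥ 1` (counting measure)**: uniformly over the
window and the box, `‖(G_k(□)⊗1)Φ‖_∞ ≤ c‖Φ‖_p` and `‖(D^η_μ⊗1)(G_k(□)⊗1)Φ‖_∞ ≤ c‖Φ‖_p`, from the same row and
column sums by `corner_sup_p` and the lift `B4Lemma22LpLqTransfer.supN_kron_le_p`.
[cite: Balaban1983RegularityDecay, Lemma 2.2 (2.17) p. 578; p. 583 (2.40)–(2.41)] -/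
theorem zero_box_psup (ι : Type) [Fintype ι] [DecidableEq ι] (d ℓ : ℕ) (hℓ : 1 ≤ ℓ)
    (amin aplus m2plus : ℝ) (ha : 0 < amin) :
    ∃ c : ℝ, 0 < c ∧ ∀ (k : ℕ), 1 ≤ k → ∀ (a m2 : ℝ), amin ≤ a → a ≤ aplus → 0 ≤ m2 → m2 ≤ m2plus →
      ∀ (M : Fin (d + 1) → ℕ), (∀ i, 1 ≤ M i) → ∀ (p : ℝ), 1 ≤ p →
        (∀ Φ : ↥(Box d ℓ k M) × ι → ℝ,
            supN ((gk d ℓ k a m2 M ⊗ₖ (1 : Matrix ι ι ℝ)) *ᵥ Φ) ≤ c * lpM p Φ) ∧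
        (∀ (μ : Fin (d + 1)) (Φ : ↥(Box d ℓ k M) × ι → ℝ),
            supN ((dk d ℓ k M μ ⊗ₖ (1 : Matrix ι ι ℝ)) *ᵥ ((gk d ℓ k a m2 M ⊗ₖ (1 : Matrix ι ι ℝ)) *ᵥ Φ))
              ≤ c * lpM p Φ) := by
  obtain ⟨c₁, hc₁, h₁⟩ := lemma22_zero_box_rowSum d ℓ hℓ amin aplus m2plus ha
  obtain ⟨c₁', hc₁', h₁'⟩ := lemma22_zero_box_colSum d ℓ hℓ amin aplus m2plus ha
  obtain ⟨c₂, hc₂, h₂⟩ := lemma22_zero_box_deriv_rowSum d ℓ hℓ amin aplus m2plus ha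
  obtain ⟨c₂', hc₂', h₂'⟩ := lemma22_zero_box_deriv_colSum d ℓ hℓ amin aplus m2plus ha
  refine ⟨max (max c₁ c₁') (max c₂ c₂'), lt_max_of_lt_left (lt_max_of_lt_left hc₁), ?_⟩
  intro k hk a m2 e1 e2 e3 e4 M hM p hp
  have hc0 : 0 ≤ max (max c₁ c₁') (max c₂ c₂') := le_max_of_le_left (le_max_of_le_left hc₁.le)
  refine ⟨fun Φ => ?_, fun μ Φ => ?_⟩
  · exact supN_kron_le_p hc0 (corner_sup_p hc0
      (fun y => (h₁ k hk a m2 e1 e2 e3 e4 M hM y).trans ((le_max_left _ _).trans (le_max_left _ _)))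
      (fun x' => (h₁' k hk a m2 e1 e2 e3 e4 M hM x').trans ((le_max_right _ _).trans (le_max_left _ _))) hp) Φ
  · rw [kron_one_mulVec_kron_one]
    refine supN_kron_le_p hc0 (corner_sup_p hc0 (fun y => ?_) (fun x' => ?_) hp) Φ
    · exact (rowSum_fdiffM_mul_le _ hc₂.le (fun x xe hxe => h₂ k hk a m2 e1 e2 e3 e4 M hM μ x xe hxe) y).trans
        ((le_max_left _ _).trans (le_max_right _ _))
    · calc ∑ x, |(dk d ℓ k M μ * gk d ℓ k a m2 M) x x'|
            = ∑ x, |((((ℓ + 1) ^ k : ℕ) : ℝ)) * (gk d ℓ k a m2 M (fwd _ μ x) x' - gk d ℓ k a m2 M x x')| :=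
              sum_congr rfl fun x _ => by rw [fdiffM_mul_apply_fwd]
        _ ≤ c₂' := h₂' k hk a m2 e1 e2 e3 e4 M hM μ x'
        _ ≤ max (max c₁ c₁') (max c₂ c₂') := (le_max_right _ _).trans (le_max_right _ _)

end ZeroField

/-! ## §7 (2.17) FOR `G_k(□,Ã)` AT ALL PAIRS `1 ≤ p ≤ q < ∞`, UNCONDITIONALLY IN THE ZERO-FIELD INPUT -/

section All

/-- for Hölder conjugates, `p ≤ q` gives `q' ≤ p'`. [folklore] -/
theorem conj_antitone {p p' q q' : ℝ} (hpc : p.HolderConjugate p') (hqc : q.HolderConjugate q') (hpq : p ≤ q) :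
    q' ≤ p' := by
  have hp := hpc.inv_add_inv_eq_inv
  have hq := hqc.inv_add_inv_eq_inv
  rw [inv_one] at hp hq
  have h1 : q⁻¹ ≤ p⁻¹ := (inv_le_inv₀ hqc.pos hpc.pos).2 hpq
  have h2 : p'⁻¹ ≤ q'⁻¹ := by linarith
  exact (inv_le_inv₀ hpc.symm.pos hqc.symm.pos).1 h2

/-- **(2.17) FOR `G_k(□,Ã)` ON A BOX, MEMBERS `G`, `D^η_{A₀,μ}G`, `D^η_{Ã,μ}G`, ALL PAIRS `1 ≤ p ≤ q < ∞`** — no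
zero-field antecedent left: `‖Gf‖_q ≤ 2C‖f‖_p`, `‖D^η_{A₀,μ}Gf‖_q ≤ 2C‖f‖_p`, `‖D^η_{Ã,μ}Gf‖_q ≤ (1+ℓθ)2C‖f‖_p` with ONE
constant `C` (of `zero_box_pq`) uniformly over the window, the box, the contour system, `A₀`, `A'` (under the
operator-side hypotheses of `B4Lemma22LpStair.lemma22_17_lp_box`) and the pair `(p,q)` — counting-measure norms; the
`η`-scaling of the printed weighted norms rides in the constant (module docstring).  `lemma22_17_pq_box` + `zero_box_pq`.
[cite: Balaban1983RegularityDecay, Lemma 2.2 (2.17) p. 578; proof pp. 579–583] -/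
theorem lemma22_17_pq_box_all (F : OrthFlow ι) {ℓ₁ : ℝ} (hℓ₁ : 0 ≤ ℓ₁)
    (hLip : ∀ t (v : ι → ℝ), ((F.U t - 1) *ᵥ v) ⬝ᵥ ((F.U t - 1) *ᵥ v) ≤ (ℓ₁ * t) ^ 2 * (v ⬝ᵥ v))
    (κ : ℝ) (d ℓ : ℕ) (hℓ : 1 ≤ ℓ) (amin aplus m2plus : ℝ) (ha : 0 < amin) :
    ∃ c : ℝ, 0 < c ∧ ∃ C : ℝ, 0 < C ∧ ∀ (k : ℕ), 1 ≤ k → ∀ (a m2 : ℝ), amin ≤ a → a ≤ aplus → 0 ≤ m2 →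
      m2 ≤ m2plus → ∀ (M : Fin (d + 1) → ℕ), (∀ i, 1 ≤ M i) →
      ∀ (emb : ↥(boxDom M) → ↥(Box d ℓ k M)) (Γ : ↥(boxDom M) → ↥(Box d ℓ k M) → List ↥(Box d ℓ k M)),
        (∀ y x, blkWt ((ℓ + 1) ^ k) M (fun i => (ℓ + 1) ^ k * M i) y x ≠ 0 → pathEnd (emb y) (Γ y x) = x) →
      ∀ (A₀ : Fin (d + 1) → ℝ) (A' : ↥(Box d ℓ k M) → ↥(Box d ℓ k M) → ℝ) (θ θ' τ : ℝ),
        IsUnit (opA d F κ ℓ k a m2 M emb Γ (constBond A₀ Subtype.val + A')).det →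
        0 ≤ θ → (∀ x y : ↥(Box d ℓ k M), y.1 ∈ nbrs x.1 → |κ * A' x y| ≤ θ / ((ℓ + 1) ^ k : ℕ)) →
        0 ≤ θ' → (∀ (x z y : ↥(Box d ℓ k M)) (μ : Fin (d + 1)), z.1 = x.1 + e1 μ → y.1 = z.1 + e1 μ →
          |κ * (A' y z - A' z x)| ≤ θ' / (((ℓ + 1) ^ k : ℕ) : ℝ) ^ 2 ∧
          |κ * (A' x z - A' z y)| ≤ θ' / (((ℓ + 1) ^ k : ℕ) : ℝ) ^ 2) →
        (∀ (x y : ↥(Box d ℓ k M)) (μ : Fin (d + 1)), y.1 = x.1 + e1 μ →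
          (x.1 - e1 μ ∉ Box d ℓ k M ∨ y.1 + e1 μ ∉ Box d ℓ k M) → A' x y = 0 ∧ A' y x = 0) →
        0 ≤ τ → (∀ y x, blkWt ((ℓ + 1) ^ k) M (fun i => (ℓ + 1) ^ k * M i) y x ≠ 0 →
          |κ * lsum A' (emb y) (Γ y x)| ≤ τ) →
        ((d : ℝ) + 2) * c * (((d : ℝ) + 1) * ℓ₁ * (θ + θ') + ((d : ℝ) + 1) * ℓ₁ * θ
          + ((d : ℝ) + 1) * ℓ₁ ^ 2 * θ ^ 2 + B1.aSeq a ((ℓ : ℝ) + 1) k * (ℓ₁ * τ * (2 + ℓ₁ * τ))) ≤ 1 / 2 →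
        ∀ (p q : ℝ), 1 ≤ p → p ≤ q →
        ∀ f : ↥(Box d ℓ k M) × ι → ℝ,
          lpM q (greenA d F κ ℓ k a m2 M emb Γ (constBond A₀ Subtype.val + A') *ᵥ f) ≤ 2 * C * lpM p f ∧
          (∀ μ : Fin (d + 1),
            lpM q (derivA0 d F κ ℓ k M A₀ μ
                *ᵥ (greenA d F κ ℓ k a m2 M emb Γ (constBond A₀ Subtype.val + A') *ᵥ f)) ≤ 2 * C * lpM p f) ∧
          ∀ μ : Fin (d + 1),
            lpM q (derivA d F κ ℓ k M (constBond A₀ Subtype.val + A') μ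
                *ᵥ (greenA d F κ ℓ k a m2 M emb Γ (constBond A₀ Subtype.val + A') *ᵥ f))
              ≤ (1 + ℓ₁ * θ) * (2 * C) * lpM p f := by
  obtain ⟨c, hc, h⟩ := lemma22_17_pq_box F hℓ₁ hLip κ d ℓ hℓ amin aplus m2plus ha
  obtain ⟨C, hC, hz⟩ := zero_box_pq ι d ℓ hℓ amin aplus m2plus ha
  refine ⟨c, hc, C, hC, ?_⟩
  intro k hk a m2 e1' e2 e3 e4 M hM emb Γ hend A₀ A' θ θ' τ hunit hθ hA' hθ' hder hbd hτ0 hτ hsm p q hp hpq f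
  obtain ⟨hz0, hzD⟩ := hz k hk a m2 e1' e2 e3 e4 M hM p q hp hpq
  exact h k hk a m2 e1' e2 e3 e4 M hM emb Γ hend A₀ A' θ θ' τ hunit hθ hA' hθ' hder hbd hτ0 hτ hsm p q hp
    (hp.trans hpq) C hC.le hz0 hzD f

/-- **(2.17) FOR `G_k(□,Ã)` ON A BOX, MEMBERS `G`, `D^η_{A₀,μ}G`, `D^η_{Ã,μ}G`, TARGET `‖·‖_∞`, EVERY `p ≥ 1`** — no
zero-field antecedent left: `‖Gf‖_∞ ≤ 2C‖f‖_p`, `‖D^η_{A₀,μ}Gf‖_∞ ≤ 2C‖f‖_p`, `‖D^η_{Ã,μ}Gf‖_∞ ≤ (1+ℓθ)2C‖f‖_p`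
(`B4Lemma22LpLqTransfer.lemma22_17_psup_box` + `zero_box_psup`; the corner «bounded operators from L^{p₁}(□) with
p₁ > d to L^∞(□)» in counting measure, here for every `p₁ ≥ 1` with a lattice-unit constant).
[cite: Balaban1983RegularityDecay, Lemma 2.2 (2.17) p. 578; p. 583] -/
theorem lemma22_17_psup_box_all (F : OrthFlow ι) {ℓ₁ : ℝ} (hℓ₁ : 0 ≤ ℓ₁)
    (hLip : ∀ t (v : ι → ℝ), ((F.U t - 1) *ᵥ v) ⬝ᵥ ((F.U t - 1) *ᵥ v) ≤ (ℓ₁ * t) ^ 2 * (v ⬝ᵥ v))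
    (κ : ℝ) (d ℓ : ℕ) (hℓ : 1 ≤ ℓ) (amin aplus m2plus : ℝ) (ha : 0 < amin) :
    ∃ c : ℝ, 0 < c ∧ ∃ C : ℝ, 0 < C ∧ ∀ (k : ℕ), 1 ≤ k → ∀ (a m2 : ℝ), amin ≤ a → a ≤ aplus → 0 ≤ m2 →
      m2 ≤ m2plus → ∀ (M : Fin (d + 1) → ℕ), (∀ i, 1 ≤ M i) →
      ∀ (emb : ↥(boxDom M) → ↥(Box d ℓ k M)) (Γ : ↥(boxDom M) → ↥(Box d ℓ k M) → List ↥(Box d ℓ k M)),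
        (∀ y x, blkWt ((ℓ + 1) ^ k) M (fun i => (ℓ + 1) ^ k * M i) y x ≠ 0 → pathEnd (emb y) (Γ y x) = x) →
      ∀ (A₀ : Fin (d + 1) → ℝ) (A' : ↥(Box d ℓ k M) → ↥(Box d ℓ k M) → ℝ) (θ θ' τ : ℝ),
        IsUnit (opA d F κ ℓ k a m2 M emb Γ (constBond A₀ Subtype.val + A')).det →
        0 ≤ θ → (∀ x y : ↥(Box d ℓ k M), y.1 ∈ nbrs x.1 → |κ * A' x y| ≤ θ / ((ℓ + 1) ^ k : ℕ)) →
        0 ≤ θ' → (∀ (x z y : ↥(Box d ℓ k M)) (μ : Fin (d + 1)), z.1 = x.1 + e1 μ → y.1 = z.1 + e1 μ →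
          |κ * (A' y z - A' z x)| ≤ θ' / (((ℓ + 1) ^ k : ℕ) : ℝ) ^ 2 ∧
          |κ * (A' x z - A' z y)| ≤ θ' / (((ℓ + 1) ^ k : ℕ) : ℝ) ^ 2) →
        (∀ (x y : ↥(Box d ℓ k M)) (μ : Fin (d + 1)), y.1 = x.1 + e1 μ →
          (x.1 - e1 μ ∉ Box d ℓ k M ∨ y.1 + e1 μ ∉ Box d ℓ k M) → A' x y = 0 ∧ A' y x = 0) →
        0 ≤ τ → (∀ y x, blkWt ((ℓ + 1) ^ k) M (fun i => (ℓ + 1) ^ k * M i) y x ≠ 0 →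
          |κ * lsum A' (emb y) (Γ y x)| ≤ τ) →
        ((d : ℝ) + 2) * c * (((d : ℝ) + 1) * ℓ₁ * (θ + θ') + ((d : ℝ) + 1) * ℓ₁ * θ
          + ((d : ℝ) + 1) * ℓ₁ ^ 2 * θ ^ 2 + B1.aSeq a ((ℓ : ℝ) + 1) k * (ℓ₁ * τ * (2 + ℓ₁ * τ))) ≤ 1 / 2 →
        ∀ (p : ℝ), 1 ≤ p →
        ∀ f : ↥(Box d ℓ k M) × ι → ℝ,
          supN (greenA d F κ ℓ k a m2 M emb Γ (constBond A₀ Subtype.val + A') *ᵥ f) ≤ 2 * C * lpM p f ∧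
          (∀ μ : Fin (d + 1),
            supN (derivA0 d F κ ℓ k M A₀ μ
                *ᵥ (greenA d F κ ℓ k a m2 M emb Γ (constBond A₀ Subtype.val + A') *ᵥ f)) ≤ 2 * C * lpM p f) ∧
          ∀ μ : Fin (d + 1),
            supN (derivA d F κ ℓ k M (constBond A₀ Subtype.val + A') μ
                *ᵥ (greenA d F κ ℓ k a m2 M emb Γ (constBond A₀ Subtype.val + A') *ᵥ f))
              ≤ (1 + ℓ₁ * θ) * (2 * C) * lpM p f := by
  obtain ⟨c, hc, h⟩ := lemma22_17_psup_box F hℓ₁ hLip κ d ℓ hℓ amin aplus m2plus ha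
  obtain ⟨C, hC, hz⟩ := zero_box_psup ι d ℓ hℓ amin aplus m2plus ha
  refine ⟨c, hc, C, hC, ?_⟩
  intro k hk a m2 e1' e2 e3 e4 M hM emb Γ hend A₀ A' θ θ' τ hunit hθ hA' hθ' hder hbd hτ0 hτ hsm p hp f
  obtain ⟨hz0, hzD⟩ := hz k hk a m2 e1' e2 e3 e4 M hM p hp
  exact h k hk a m2 e1' e2 e3 e4 M hM emb Γ hend A₀ A' θ θ' τ hunit hθ hA' hθ' hder hbd hτ0 hτ hsm p hp C hC.le
    hz0 hzD f

/-- **(2.17) FOR `G_k(□,Ã)` ON A BOX, THIRD MEMBER `G(D^η_{A₀,μ})ᵀ`, `G(D^η_{Ã,μ})ᵀ`, ALL PAIRS `1 < p ≤ q < ∞`** — no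
zero-field antecedent left: `‖G(D^η_μ)ᵀf‖_q ≤ 2C‖f‖_p`, `≤ (1+ℓθ)2C‖f‖_p`, by `B4Lemma22LpLqTransfer.lemma22_17_pq_box_dual`
(«Again by the duality argument») fed with `zero_box_pq` at the dual pair `(q', p')` (`q' ≤ p'`, `conj_antitone`).
[cite: Balaban1983RegularityDecay, Lemma 2.2 (2.17) p. 578; p. 581; p. 583] -/
theorem lemma22_17_pq_box_dual_all (F : OrthFlow ι) {ℓ₁ : ℝ} (hℓ₁ : 0 ≤ ℓ₁)
    (hLip : ∀ t (v : ι → ℝ), ((F.U t - 1) *ᵥ v) ⬝ᵥ ((F.U t - 1) *ᵥ v) ≤ (ℓ₁ * t) ^ 2 * (v ⬝ᵥ v))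
    (κ : ℝ) (d ℓ : ℕ) (hℓ : 1 ≤ ℓ) (amin aplus m2plus : ℝ) (ha : 0 < amin) :
    ∃ c : ℝ, 0 < c ∧ ∃ C : ℝ, 0 < C ∧ ∀ (k : ℕ), 1 ≤ k → ∀ (a m2 : ℝ), amin ≤ a → a ≤ aplus → 0 ≤ m2 →
      m2 ≤ m2plus → ∀ (M : Fin (d + 1) → ℕ), (∀ i, 1 ≤ M i) →
      ∀ (emb : ↥(boxDom M) → ↥(Box d ℓ k M)) (Γ : ↥(boxDom M) → ↥(Box d ℓ k M) → List ↥(Box d ℓ k M)),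
        (∀ y x, blkWt ((ℓ + 1) ^ k) M (fun i => (ℓ + 1) ^ k * M i) y x ≠ 0 → pathEnd (emb y) (Γ y x) = x) →
      ∀ (A₀ : Fin (d + 1) → ℝ) (A' : ↥(Box d ℓ k M) → ↥(Box d ℓ k M) → ℝ) (θ θ' τ : ℝ),
        IsUnit (opA d F κ ℓ k a m2 M emb Γ (constBond A₀ Subtype.val + A')).det →
        0 ≤ θ → (∀ x y : ↥(Box d ℓ k M), y.1 ∈ nbrs x.1 → |κ * A' x y| ≤ θ / ((ℓ + 1) ^ k : ℕ)) →
        0 ≤ θ' → (∀ (x z y : ↥(Box d ℓ k M)) (μ : Fin (d + 1)), z.1 = x.1 + e1 μ → y.1 = z.1 + e1 μ →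
          |κ * (A' y z - A' z x)| ≤ θ' / (((ℓ + 1) ^ k : ℕ) : ℝ) ^ 2 ∧
          |κ * (A' x z - A' z y)| ≤ θ' / (((ℓ + 1) ^ k : ℕ) : ℝ) ^ 2) →
        (∀ (x y : ↥(Box d ℓ k M)) (μ : Fin (d + 1)), y.1 = x.1 + e1 μ →
          (x.1 - e1 μ ∉ Box d ℓ k M ∨ y.1 + e1 μ ∉ Box d ℓ k M) → A' x y = 0 ∧ A' y x = 0) →
        0 ≤ τ → (∀ y x, blkWt ((ℓ + 1) ^ k) M (fun i => (ℓ + 1) ^ k * M i) y x ≠ 0 →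
          |κ * lsum A' (emb y) (Γ y x)| ≤ τ) →
        ((d : ℝ) + 2) * c * (((d : ℝ) + 1) * ℓ₁ * (θ + θ') + ((d : ℝ) + 1) * ℓ₁ * θ
          + ((d : ℝ) + 1) * ℓ₁ ^ 2 * θ ^ 2 + B1.aSeq a ((ℓ : ℝ) + 1) k * (ℓ₁ * τ * (2 + ℓ₁ * τ))) ≤ 1 / 2 →
        ∀ (p p' q q' : ℝ), p.HolderConjugate p' → q.HolderConjugate q' → p ≤ q →
        ∀ f : ↥(Box d ℓ k M) × ι → ℝ,
          (∀ μ : Fin (d + 1),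
            lpM q ((greenA d F κ ℓ k a m2 M emb Γ (constBond A₀ Subtype.val + A')
                * (derivA0 d F κ ℓ k M A₀ μ)ᵀ) *ᵥ f) ≤ 2 * C * lpM p f) ∧
          ∀ μ : Fin (d + 1),
            lpM q ((greenA d F κ ℓ k a m2 M emb Γ (constBond A₀ Subtype.val + A')
                * (derivA d F κ ℓ k M (constBond A₀ Subtype.val + A') μ)ᵀ) *ᵥ f)
              ≤ (1 + ℓ₁ * θ) * (2 * C) * lpM p f := by
  obtain ⟨c, hc, h⟩ := lemma22_17_pq_box_dual F hℓ₁ hLip κ d ℓ hℓ amin aplus m2plus ha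
  obtain ⟨C, hC, hz⟩ := zero_box_pq ι d ℓ hℓ amin aplus m2plus ha
  refine ⟨c, hc, C, hC, ?_⟩
  intro k hk a m2 e1' e2 e3 e4 M hM emb Γ hend A₀ A' θ θ' τ hunit hθ hA' hθ' hder hbd hτ0 hτ hsm p p' q q' hpc hqc
    hpq f
  obtain ⟨hz0, hzD⟩ := hz k hk a m2 e1' e2 e3 e4 M hM q' p' hqc.symm.lt.le (conj_antitone hpc hqc hpq)
  exact h k hk a m2 e1' e2 e3 e4 M hM emb Γ hend A₀ A' θ θ' τ hunit hθ hA' hθ' hder hbd hτ0 hτ hsm p p' q q' hpc hqc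
    C hC.le hz0 hzD f

/-- **(2.17) FOR `G_k(□,Ã)` ON A FINE BOX WITH THE STAIRCASE CONTOURS, MEMBERS `G`, `D^η_{A₀,μ}G`, `D^η_{Ã,μ}G`, ALL
PAIRS `1 ≤ p ≤ q < ∞`, EVERYTHING DISCHARGED** but the printed smallness hypotheses on the field: one constant `C`,
`‖Gf‖_q ≤ 2C‖f‖_p`, `‖D^η_{A₀,μ}Gf‖_q ≤ 2C‖f‖_p`, `‖D^η_{Ã,μ}Gf‖_q ≤ (1+ℓθ)2C‖f‖_p` (counting-measure norms).
`B4Lemma22LpLqTransfer.lemma22_17_pq_stair` + `zero_box_pq`.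
[cite: Balaban1983RegularityDecay, Lemma 2.2 (2.17) p. 578; proof pp. 579–583] -/
theorem lemma22_17_pq_stair_all (F : OrthFlow ι) {ℓ₁ : ℝ} (hℓ₁ : 0 ≤ ℓ₁)
    (hLip : ∀ t (v : ι → ℝ), ((F.U t - 1) *ᵥ v) ⬝ᵥ ((F.U t - 1) *ᵥ v) ≤ (ℓ₁ * t) ^ 2 * (v ⬝ᵥ v))
    (κ : ℝ) (d ℓ : ℕ) (hℓ : 1 ≤ ℓ) (amin aplus m2plus : ℝ) (ha : 0 < amin) :
    ∃ c : ℝ, 0 < c ∧ ∃ C : ℝ, 0 < C ∧ ∀ (k : ℕ), 1 ≤ k → ∀ (hn : 1 ≤ (ℓ + 1) ^ k) (a m2 : ℝ),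
      amin ≤ a → a ≤ aplus → 0 ≤ m2 → m2 ≤ m2plus →
      ∀ (M : Fin (d + 1) → ℕ), (∀ i, 1 ≤ M i) →
      ∀ (A₀ : Fin (d + 1) → ℝ) (A' : ↥(Box d ℓ k M) → ↥(Box d ℓ k M) → ℝ) (θ θ' : ℝ),
        0 ≤ θ → (∀ x y : ↥(Box d ℓ k M), y.1 ∈ nbrs x.1 → |κ * A' x y| ≤ θ / ((ℓ + 1) ^ k : ℕ)) →
        0 ≤ θ' → (∀ (x z y : ↥(Box d ℓ k M)) (μ : Fin (d + 1)), z.1 = x.1 + e1 μ → y.1 = z.1 + e1 μ →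
          |κ * (A' y z - A' z x)| ≤ θ' / (((ℓ + 1) ^ k : ℕ) : ℝ) ^ 2 ∧
          |κ * (A' x z - A' z y)| ≤ θ' / (((ℓ + 1) ^ k : ℕ) : ℝ) ^ 2) →
        (∀ (x y : ↥(Box d ℓ k M)) (μ : Fin (d + 1)), y.1 = x.1 + e1 μ →
          (x.1 - e1 μ ∉ Box d ℓ k M ∨ y.1 + e1 μ ∉ Box d ℓ k M) → A' x y = 0 ∧ A' y x = 0) →
        ℓ₁ ^ 2 * θ ^ 2 * ((d : ℝ) + 1) * (1 + B1.aSeq a ((ℓ : ℝ) + 1) k * ((d : ℝ) + 1))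
          ≤ min 2 (B1.aSeq a ((ℓ : ℝ) + 1) k) / 4 →
        ((d : ℝ) + 2) * c * (((d : ℝ) + 1) * ℓ₁ * (θ + θ') + ((d : ℝ) + 1) * ℓ₁ * θ
          + ((d : ℝ) + 1) * ℓ₁ ^ 2 * θ ^ 2
          + B1.aSeq a ((ℓ : ℝ) + 1) k * (ℓ₁ * (((d : ℝ) + 1) * θ) * (2 + ℓ₁ * (((d : ℝ) + 1) * θ)))) ≤ 1 / 2 →
        ∀ (p q : ℝ), 1 ≤ p → p ≤ q →
        ∀ f : ↥(Box d ℓ k M) × ι → ℝ,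
          lpM q (greenA d F κ ℓ k a m2 M (baseEmb hn M) (stairContour hn M) (constBond A₀ Subtype.val + A') *ᵥ f)
              ≤ 2 * C * lpM p f ∧
          (∀ μ : Fin (d + 1),
            lpM q (derivA0 d F κ ℓ k M A₀ μ
                *ᵥ (greenA d F κ ℓ k a m2 M (baseEmb hn M) (stairContour hn M) (constBond A₀ Subtype.val + A')
                    *ᵥ f)) ≤ 2 * C * lpM p f) ∧
          ∀ μ : Fin (d + 1),
            lpM q (derivA d F κ ℓ k M (constBond A₀ Subtype.val + A') μ
                *ᵥ (greenA d F κ ℓ k a m2 M (baseEmb hn M) (stairContour hn M) (constBond A₀ Subtype.val + A')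
                    *ᵥ f))
              ≤ (1 + ℓ₁ * θ) * (2 * C) * lpM p f := by
  obtain ⟨c, hc, h⟩ := lemma22_17_pq_stair F hℓ₁ hLip κ d ℓ hℓ amin aplus m2plus ha
  obtain ⟨C, hC, hz⟩ := zero_box_pq ι d ℓ hℓ amin aplus m2plus ha
  refine ⟨c, hc, C, hC, ?_⟩
  intro k hk hn a m2 e1' e2 e3 e4 M hM A₀ A' θ θ' hθ hA' hθ' hder hbd hsm2 hsm p q hp hpq f
  obtain ⟨hz0, hzD⟩ := hz k hk a m2 e1' e2 e3 e4 M hM p q hp hpq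
  exact h k hk hn a m2 e1' e2 e3 e4 M hM A₀ A' θ θ' hθ hA' hθ' hder hbd hsm2 hsm p q hp (hp.trans hpq) C hC.le
    hz0 hzD f

end All




end

end Literature.MathematicalPhysics.QuantumFieldTheory.Balaban1983to89.B4Lemma22InterpBox
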